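import Mathlib
import HarnessLib
import Literature.Analysis.PDE.ConservationLawWeakStrong
import Literature.Analysis.PDE.ConservationLawWeakStrongUniqueness

/-!
# Weak–strong uniqueness for measure-valued solutions of hyperbolic conservation laws
# (Brenier–De Lellis–Székelyhidi 2011, Theorem 3)

Named fact (D-0014: `def … : Prop`, no proof) vendoring

> **Theorem 3** of Y. Brenier, C. De Lellis, L. Székelyhidi Jr., *Weak-strong uniqueness for
> measure-valued solutions*, Comm. Math. Phys. **305** (2011) 351–361, § 4 "Hyperbolic systems of
> conservation laws" (p. 7 of the arXiv text 0912.1028 materialised in this session)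
> [BrenierDeLellisSzekelyhidi2011]. Setting (§ 4): `∂ₜU + div_x F(U) = 0`,
> `U : [0,T] × ℝⁿ → ℝᵏ`, `F : ℝᵏ → ℝ^{n×k}` a `C²` map, endowed with a strictly convex entropy,
> i.e. a `C²` map `(η,q) : ℝᵏ → ℝ × ℝⁿ` with `D²η ≥ c₀ Id > 0` and `∂ᵢη ∂ₗF^{ij} = ∂ₗq^j`.
> **Definition 2.** A bounded admissible measure-valued solution `ν` of (CL) with initial data
> `U₀ ∈ L^∞` is a parametrized family of probability measures `ν ∈ 𝒫([0,T]×ℝⁿ; ℝᵏ)` such that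
> • `t ↦ ⟨ν_{t,·}, ξ⟩` is a weakly* continuous map, taking values in `L^∞(ℝⁿ)`;
> • the identity `∂ₜ⟨ν,ξ⟩ + div_x⟨ν,F(ξ)⟩ = 0`, `⟨ν_{0,x},ξ⟩ = U₀(x)` holds in the sense of
>   distributions;
> • the inequality `∂ₜ⟨ν,η(ξ)⟩ + div_x⟨ν,q(ξ)⟩ ≤ 0`, `⟨ν_{0,x},η(ξ)⟩ = η(U₀(x))` holds in the
>   sense of distributions.
> **Theorem 3.** Assume `U : [0,T]×ℝⁿ → ℝᵏ` is a bounded Lipschitz solution of (CL) and `ν` a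
> bounded admissible measure valued solution of (CL) with initial data `U₀ = U(0,·)`. Then
> `ν_{t,x} = δ_{U(t,x)}` for a.e. `(t,x) ∈ [0,T]×ℝⁿ`.
> ("The proof follows essentially the computations of pages 98–100 in [Dafermos's book]";
> originally Dafermos 1979 / DiPerna 1979 for `L^∞` weak solutions, DiPerna 1985 for
> measure-valued solutions of scalar laws.)

This is the measure-valued companion of `dafermos_weak_strong_uniqueness`
(`ConservationLawWeakStrong.lean`, proved in-tree), which covers only FUNCTION-valued admissible
weak solutions; Young-measure limits of approximating sequences (oscillating particle fields,
vanishing viscosity) need the present statement.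

## Formalisation choices (each makes the fact weaker than or equal to print)

* Space dimension `m`, state dimension `n` (the file `ConservationLawWeakStrong.lean` convention;
  BDS write `n`, `k`); points `(t,x) : ℝ × EuclideanSpace ℝ (Fin m)`, time first; the flux is given
  by its columns `G α : ℝⁿ → ℝⁿ`, `α : Fin m`, as in loc. cit.
* "parametrized family of probability measures, bounded": every `ν t x` is a probability measure
  on `ℝⁿ` carried by one fixed closed ball, and `(t,x) ↦ ⟨ν_{t,x}, g⟩` is measurable for every
  continuous `g` (the measurability implicit in "parametrized family"/Young measure).
* weak* continuity of `t ↦ ⟨ν_{t,·},ξ⟩` into `L^∞(ℝⁿ)` is imposed against EVERY integrable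
  `φ : ℝⁿ → ℝ` on `[0,T]` (as printed; a hypothesis, so asking it in full strength is conservative).
* "in the sense of distributions" for the two Cauchy problems of Definition 2 is the
  time-boundary-integrated form against `C¹` test functions compactly supported in
  `ℝ × ℝⁿ` and vanishing for `t ≥ T'`, some `T' < T` (`ConservationLaw.IsTestFunction`,
  `testTimeDeriv`, `testSpaceDeriv` of loc. cit.; BDS use `ψ ∈ C_c^∞(ℝⁿ × ]−T,T[)` and note that
  "no boundary term appears because the initial condition is the same" — i.e. exactly these
  integrated forms); the pairings `⟨ν,G_α⟩, ⟨ν,η⟩, ⟨ν,q_α⟩` are asked to be locally integrable on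
  the slab so that no Bochner integral is a silent junk `0` (automatic in print from boundedness).
* "bounded Lipschitz solution `U` on `[0,T]×ℝⁿ`": `U` is Lipschitz on `[0,T] × ℝⁿ` and is a weak
  solution on `[0,T)` with its own `t = 0` slice as datum (`ConservationLaw.IsWeakSolution` with
  state domain `univ`; for Lipschitz `U` this is "solution" in any sense).
* `F, η, q` are `C²` on all of `ℝⁿ` with `D²η ≥ c₀ Id` globally, as printed in § 4.
* Conclusion a.e. on `(0,T) × ℝⁿ` (the printed `[0,T]×ℝⁿ` differs by a null set).

Grounds `Summit.AtomisticToContinuum.HydrodynamicLimit.Theses.BurgersZoomLadder.PreShockAssembly`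
(its step "limit Young measures are measure-valued solutions of Burgers with the single convex
entropy inequality from `s = 0` … ⇒ `ν = δ_w` pre-shock": this fact with `m = n = 1`,
`G = βu²/2`, `η = u²/2`, `q = βu³/3`, after the periodic lift `UnitAddCircle → ℝ`).
-/

noncomputable section

open MeasureTheory Set
open scoped BigOperators

namespace Literature.Analysis.PDE

namespace ConservationLaw

variable {m n : ℕ}

/-- **Bounded admissible measure-valued solution with initial data `U₀`** (Brenier–De Lellis–
Székelyhidi 2011, Definition 2, transcribed as explained in the module docstring): a measurable,
uniformly compactly supported family of probability measures `ν_{t,x}` on the state space with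
`t ↦ ⟨ν_{t,·},ξ⟩` weakly* continuous on `[0,T]`, solving the Cauchy problem for
`∂ₜ⟨ν,ξ⟩ + ∑_α ∂_α⟨ν,G_α(ξ)⟩ = 0` with datum `U₀` and the single entropy inequality for `(η,q)`
with datum `η(U₀)`, both in the time-boundary-integrated distributional form.
[cite: BrenierDeLellisSzekelyhidi2011, Def. 2 §4] -/
def IsAdmissibleMVSolution
    (G : Fin m → EuclideanSpace ℝ (Fin n) → EuclideanSpace ℝ (Fin n))
    (η : EuclideanSpace ℝ (Fin n) → ℝ) (q : Fin m → EuclideanSpace ℝ (Fin n) → ℝ) (T : ℝ)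
    (ν : ℝ → EuclideanSpace ℝ (Fin m) → Measure (EuclideanSpace ℝ (Fin n)))
    (U₀ : EuclideanSpace ℝ (Fin m) → EuclideanSpace ℝ (Fin n)) : Prop :=
  (∀ t x, IsProbabilityMeasure (ν t x)) ∧
  (∃ K : ℝ, (∀ t x, ν t x (Metric.closedBall 0 K)ᶜ = 0) ∧ ∀ x, ‖U₀ x‖ ≤ K) ∧
  Measurable U₀ ∧
  (∀ g : EuclideanSpace ℝ (Fin n) → ℝ, Continuous g →
    Measurable (fun p : ℝ × EuclideanSpace ℝ (Fin m) => ∫ ξ, g ξ ∂ν p.1 p.2)) ∧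
  (∀ φ : EuclideanSpace ℝ (Fin m) → ℝ, Integrable φ →
    ContinuousOn (fun t : ℝ => ∫ x, φ x • (∫ ξ, ξ ∂ν t x)) (Set.Icc 0 T)) ∧
  (∀ α, LocallyIntegrableOn
    (fun p : ℝ × EuclideanSpace ℝ (Fin m) => ∫ ξ, G α ξ ∂ν p.1 p.2) (Set.Ico 0 T ×ˢ Set.univ)) ∧
  LocallyIntegrableOn
    (fun p : ℝ × EuclideanSpace ℝ (Fin m) => ∫ ξ, η ξ ∂ν p.1 p.2) (Set.Ico 0 T ×ˢ Set.univ) ∧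
  (∀ α, LocallyIntegrableOn
    (fun p : ℝ × EuclideanSpace ℝ (Fin m) => ∫ ξ, q α ξ ∂ν p.1 p.2) (Set.Ico 0 T ×ˢ Set.univ)) ∧
  (∀ φ : ℝ × EuclideanSpace ℝ (Fin m) → ℝ, IsTestFunction T φ →
    (∫ t in Set.Ioo 0 T, ∫ x,
        (testTimeDeriv φ t x • (∫ ξ, ξ ∂ν t x)
          + ∑ α : Fin m, testSpaceDeriv φ α t x • (∫ ξ, G α ξ ∂ν t x)))
      + ∫ x, φ (0, x) • U₀ x = 0) ∧
  (∀ ψ : ℝ × EuclideanSpace ℝ (Fin m) → ℝ, IsTestFunction T ψ → (∀ p, 0 ≤ ψ p) →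
    0 ≤ (∫ t in Set.Ioo 0 T, ∫ x,
        (testTimeDeriv ψ t x * (∫ ξ, η ξ ∂ν t x)
          + ∑ α : Fin m, testSpaceDeriv ψ α t x * (∫ ξ, q α ξ ∂ν t x)))
      + ∫ x, ψ (0, x) * η (U₀ x))

/-- **Weak–strong uniqueness for measure-valued solutions (Brenier–De Lellis–Székelyhidi 2011,
Theorem 3).** Printed: "Assume `U : [0,T]×ℝⁿ → ℝᵏ` is a bounded Lipschitz solution of (CL) and
`ν` a bounded admissible measure valued solution of (CL) with initial data `U₀ = U(0,·)`. Then
`ν_{t,x} = δ_{U(t,x)}` for a.e. `(t,x) ∈ [0,T]×ℝⁿ`", for a system `∂ₜU + div_x F(U) = 0` with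
`F ∈ C²` endowed with a strictly convex entropy pair `(η,q) ∈ C²`, `D²η ≥ c₀ Id > 0`,
`Dq_α = Dη DF_α`. Recorded with the flux by columns `G_α`, `T > 0`, `U` Lipschitz on
`[0,T] × ℝᵐ` and a weak solution on `[0,T)` with datum `U(0,·)` (state domain `univ`), and the
conclusion a.e. on `(0,T) × ℝᵐ`. A single convex entropy inequality selects the classical solution
among all Young-measure-valued solutions for as long as the classical solution exists. Grounds
`Summit.AtomisticToContinuum.HydrodynamicLimit.Theses.BurgersZoomLadder.PreShockAssembly`
(`m = n = 1`, Burgers flux `βu²/2`, entropy `u²/2`).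
[cite: BrenierDeLellisSzekelyhidi2011, Thm 3] -/
def brenierDeLellisSzekelyhidi_mv_weak_strong_uniqueness : Prop :=
  ∀ (m n : ℕ) (G : Fin m → EuclideanSpace ℝ (Fin n) → EuclideanSpace ℝ (Fin n))
    (η : EuclideanSpace ℝ (Fin n) → ℝ) (q : Fin m → EuclideanSpace ℝ (Fin n) → ℝ),
    (∀ α, ContDiff ℝ 2 (G α)) → ContDiff ℝ 2 η → (∀ α, ContDiff ℝ 2 (q α)) →
    (∀ V α, fderiv ℝ (q α) V = (fderiv ℝ η V).comp (fderiv ℝ (G α) V)) →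
    (∃ c₀ : ℝ, 0 < c₀ ∧ ∀ V ξ : EuclideanSpace ℝ (Fin n),
      c₀ * ‖ξ‖ ^ 2 ≤ iteratedFDeriv ℝ 2 η V ![ξ, ξ]) →
  ∀ T : ℝ, 0 < T →
  ∀ U : ℝ → EuclideanSpace ℝ (Fin m) → EuclideanSpace ℝ (Fin n),
    (∃ K : NNReal, LipschitzOnWith K (Function.uncurry U) (Set.Icc 0 T ×ˢ Set.univ)) →
    IsWeakSolution Set.univ G T U (U 0) →
  ∀ ν : ℝ → EuclideanSpace ℝ (Fin m) → Measure (EuclideanSpace ℝ (Fin n)),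
    IsAdmissibleMVSolution G η q T ν (U 0) →
  ∀ᵐ p : ℝ × EuclideanSpace ℝ (Fin m), p.1 ∈ Set.Ioo 0 T → ν p.1 p.2 = Measure.dirac (U p.1 p.2)

end ConservationLaw

end Literature.Analysis.PDE

/-!
# Proof of Theorem 3 (appended proof section, theorems only)

The discharge `brenierDeLellisSzekelyhidi_mv_weak_strong_uniqueness_holds` of the named fact
`brenierDeLellisSzekelyhidi_mv_weak_strong_uniqueness` above (Y. Brenier, C. De Lellis,
L. Székelyhidi Jr., *Weak-strong uniqueness for measure-valued solutions*, Comm. Math. Phys.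
**305** (2011) 351–361, Theorem 3, arXiv 0912.1028 pp. 7–9 [BrenierDeLellisSzekelyhidi2011]).

We follow the printed proof, which "follows essentially the computations of pages 98–100 in
[Dafermos's book]" with the admissible weak solution `U` replaced by the pairings
`⟨ν,ξ⟩, ⟨ν,F(ξ)⟩, ⟨ν,η(ξ)⟩, ⟨ν,q(ξ)⟩` of the Young measure. The in-tree formalization of
Dafermos' Theorem 5.2.1 (`ConservationLawWeakStrongUniqueness.lean`,
`dafermos_weak_strong_uniqueness_holds`) uses the weak solution `U` only through
(i) the weak identity tested with Lipschitz test functions, (ii) the entropy inequality tested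
with nonnegative Lipschitz test functions, (iii) measurability and `L^∞` bounds of the four
fields `U, G_α(U), η(U), q_α(U)` on the slab, and (iv) the pointwise bounds `h ≥ 0`,
`∑_α |Y_α| ≤ s h`, `‖Z_α‖ ≤ C h` of Dafermos (5.2.5) = BDS (5.3.4)–(5.3.5bis). Accordingly:

* `weakIdentity_lipschitz_of_fields`, `entropyIneq_lipschitz_of_fields` — (i), (ii) for
  ABSTRACT bounded measurable fields satisfying the `C¹`-tested identity / inequality
  (mollification, `tendsto_pairing_mollify`; BDS: "by an easy approximation argument,
  (5.3.6) holds for any test function which is just Lipschitz continuous");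
* `relEntropy_ineq_fields` — BDS (5.3.10) = Dafermos (5.2.10): for abstract fields
  `(u, g_α, e, r_α)` satisfying (i)–(iii) and a classical (Lipschitz) solution `Ū`,
  `∫∫ ψ ∑_α D²η(Ū)[∂_αŪ, Z_α] ≤ ∫∫ [∂ₜψ h + ∑_α ∂_αψ Y_α]` (`C²` data suffice);
* `relEntropy_vanish_fields` — BDS (5.3.11)–(5.3.15): (5.3.10) plus the structural bounds (iv)
  force `h = 0` a.e. on the slab (Grönwall, implemented as in the in-tree Dafermos proof by the
  test function `Θ(t)χ(t,x)`, `exists_timeProfile`, `exists_coneCutoff`);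
* `brenierDeLellisSzekelyhidi_mv_weak_strong_uniqueness_holds` — the discharge: the pairings of
  a bounded admissible measure-valued solution are such fields, the bounds (iv) follow by
  integrating the pointwise quadratic bounds (`relEntropy_lower`, `fluxDefect_le`,
  `taylorDefect_le`) against the probability measures `ν_{t,x}` (BDS (5.3.4)–(5.3.5bis)), and
  `h = 0` gives `∫ |ξ - Ū|² dν_{t,x} = 0`, i.e. `ν_{t,x} = δ_{Ū(t,x)}` (BDS (e:other_side)).

[cite: BrenierDeLellisSzekelyhidi2011, Thm 3]

## References

* Y. Brenier, C. De Lellis, L. Székelyhidi Jr., *Weak-strong uniqueness for measure-valued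
  solutions*, Comm. Math. Phys. 305 (2011) 351–361, §4, Thm 3 [BrenierDeLellisSzekelyhidi2011].
* C. M. Dafermos, *Hyperbolic Conservation Laws in Continuum Physics*, Springer 2000, Thm 5.2.1
  [Dafermos2000].
-/

open Filter Metric ContinuousLinearMap
open scoped Topology NNReal Convolution

namespace Literature.Analysis.PDE.ConservationLaw

variable {m n : ℕ}

/-! ## Pairings against a compactly supported probability measure -/

/-- A measure carried by `A` (`μ Aᶜ = 0`) is a.e. in `A`. This is Mathlib's `MeasureTheory.mem_ae_iff`
(an `Iff.rfl`) read as an `ae` statement; kept only as a deprecated alias — use `mem_ae_iff.2 h`.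
[folklore] -/
@[deprecated MeasureTheory.mem_ae_iff (since := "2026-08-16")]
theorem ae_mem_of_measure_compl_eq_zero {X : Type*} [MeasurableSpace X] {μ : Measure X}
    {A : Set X} (h : μ Aᶜ = 0) : ∀ᵐ x ∂μ, x ∈ A :=
  mem_ae_iff.2 h

/-- A continuous function is integrable against a finite measure a.e. carried by a compact set.
[folklore] -/
theorem integrable_of_continuous_of_ae_mem {X W : Type*} [TopologicalSpace X] [MeasurableSpace X]
    [OpensMeasurableSpace X] [SecondCountableTopology X] [NormedAddCommGroup W]
    {μ : Measure X} [IsFiniteMeasure μ] {D : Set X} (hDc : IsCompact D) (hμD : ∀ᵐ x ∂μ, x ∈ D)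
    {θ : X → W} (hθ : Continuous θ) : Integrable θ μ := by
  obtain ⟨M, hM⟩ := hDc.exists_bound_of_continuousOn hθ.continuousOn
  refine Integrable.of_bound hθ.aestronglyMeasurable M ?_
  filter_upwards [hμD] with x hx
  exact hM x hx

/-- `‖∫ θ dμ‖ ≤ M` for a probability measure a.e. carried by a set on which `‖θ‖ ≤ M`.
[folklore] -/
theorem norm_integral_le_of_ae_mem {X W : Type*} [MeasurableSpace X] [NormedAddCommGroup W]
    [NormedSpace ℝ W] {μ : Measure X} [IsProbabilityMeasure μ] {D : Set X}
    (hμD : ∀ᵐ x ∂μ, x ∈ D) {θ : X → W} {M : ℝ} (hM : ∀ x ∈ D, ‖θ x‖ ≤ M) :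
    ‖∫ x, θ x ∂μ‖ ≤ M := by
  have h : ∀ᵐ x ∂μ, ‖θ x‖ ≤ M := by
    filter_upwards [hμD] with x hx
    exact hM x hx
  simpa using norm_integral_le_of_norm_le_const h

/-- First-order Taylor remainders commute with averaging against a probability measure:
`⟨μ,a⟩ - a₀ - L(⟨μ,b⟩ - b₀) = ∫ [a - a₀ - L(b - b₀)] dμ`. [folklore] -/
theorem integral_taylorRemainder_eq {X W₁ W₂ : Type*} [MeasurableSpace X]
    [NormedAddCommGroup W₁] [NormedSpace ℝ W₁] [CompleteSpace W₁]
    [NormedAddCommGroup W₂] [NormedSpace ℝ W₂] [CompleteSpace W₂]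
    {μ : Measure X} [IsProbabilityMeasure μ] {a : X → W₁} {b : X → W₂}
    (ha : Integrable a μ) (hb : Integrable b μ) (L : W₂ →L[ℝ] W₁) (a₀ : W₁) (b₀ : W₂) :
    (∫ x, a x ∂μ) - a₀ - L ((∫ x, b x ∂μ) - b₀) = ∫ x, (a x - a₀ - L (b x - b₀)) ∂μ := by
  have h0 : Integrable (fun x => b x - b₀) μ := hb.sub (integrable_const _)
  have h1 : Integrable (fun x => L (b x - b₀)) μ := L.integrable_comp h0
  have h2 : Integrable (fun x => a x - a₀) μ := ha.sub (integrable_const _)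
  have e1 : ∫ x, (a x - a₀ - L (b x - b₀)) ∂μ = (∫ x, (a x - a₀) ∂μ) - ∫ x, L (b x - b₀) ∂μ :=
    integral_sub h2 h1
  have e2 : ∫ x, (a x - a₀) ∂μ = (∫ x, a x ∂μ) - ∫ _, a₀ ∂μ := integral_sub ha (integrable_const _)
  have e3 : ∫ x, L (b x - b₀) ∂μ = L (∫ x, (b x - b₀) ∂μ) := L.integral_comp_comm h0
  have e4 : ∫ x, (b x - b₀) ∂μ = (∫ x, b x ∂μ) - ∫ _, b₀ ∂μ := integral_sub hb (integrable_const _)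
  rw [e1, e2, e3, e4, integral_const, integral_const]
  simp

/-- A probability measure a.e. equal to a point is the Dirac mass at that point. [folklore] -/
theorem eq_dirac_of_ae_eq {X : Type*} [MeasurableSpace X] [MeasurableSingletonClass X]
    {μ : Measure X} [IsProbabilityMeasure μ] {a : X} (h : ∀ᵐ x ∂μ, x = a) :
    μ = Measure.dirac a := by
  have hμ : μ {a}ᶜ = 0 := by
    rw [ae_iff] at h
    have : ({a}ᶜ : Set X) = {x | ¬x = a} := by
      ext x
      simp
    rw [this]
    exact h
  ext s hs
  by_cases has : a ∈ s
  · rw [Measure.dirac_apply_of_mem has]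
    refine le_antisymm prob_le_one ?_
    have h1 : μ sᶜ = 0 :=
      measure_mono_null (compl_subset_compl.2 (singleton_subset_iff.2 has)) hμ
    have h2 := measure_add_measure_compl (μ := μ) hs
    rw [h1, add_zero, measure_univ] at h2
    exact h2.ge
  · rw [Measure.dirac_apply' _ hs, Set.indicator_of_notMem has]
    refine measure_mono_null (fun x hx => ?_) hμ
    rw [Set.mem_compl_iff, Set.mem_singleton_iff]
    rintro rfl
    exact has hx

/-- A map into `ℝⁿ` with measurable coordinates is measurable. [folklore] -/
theorem measurable_of_measurable_coord {X : Type*} [MeasurableSpace X]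
    {f : X → EuclideanSpace ℝ (Fin n)} (hf : ∀ i, Measurable fun x => f x i) : Measurable f := by
  have h1 : Measurable fun x => (WithLp.ofLp (f x) : Fin n → ℝ) := measurable_pi_iff.2 hf
  have h2 : Measurable fun x => WithLp.toLp 2 (WithLp.ofLp (f x)) :=
    (WithLp.measurable_toLp 2 _).comp h1
  simpa only [WithLp.toLp_ofLp] using h2

/-- **Measurability of vector pairings from scalar ones.** If `(t,x) ↦ ⟨ν_{t,x}, g⟩` is
measurable for every continuous scalar `g`, then so is `(t,x) ↦ ⟨ν_{t,x}, θ⟩` for a continuous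
vector-valued `θ` integrable against every `ν_{t,x}` (coordinatewise). [folklore] -/
theorem measurable_integral_fibre
    {ν : ℝ → EuclideanSpace ℝ (Fin m) → Measure (EuclideanSpace ℝ (Fin n))}
    (hmeas : ∀ g : EuclideanSpace ℝ (Fin n) → ℝ, Continuous g →
      Measurable fun p : ℝ × EuclideanSpace ℝ (Fin m) => ∫ ξ, g ξ ∂ν p.1 p.2)
    {θ : EuclideanSpace ℝ (Fin n) → EuclideanSpace ℝ (Fin n)} (hθ : Continuous θ)
    (hint : ∀ t x, Integrable θ (ν t x)) :
    Measurable fun p : ℝ × EuclideanSpace ℝ (Fin m) => ∫ ξ, θ ξ ∂ν p.1 p.2 := by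
  refine measurable_of_measurable_coord fun i => ?_
  have h1 : ∀ p : ℝ × EuclideanSpace ℝ (Fin m),
      (∫ ξ, θ ξ ∂ν p.1 p.2) i = ∫ ξ, θ ξ i ∂ν p.1 p.2 := by
    intro p
    have := (EuclideanSpace.proj i : EuclideanSpace ℝ (Fin n) →L[ℝ] ℝ).integral_comp_comm
      (hint p.1 p.2)
    simpa using this.symm
  simp_rw [h1]
  have hc : Continuous fun ξ : EuclideanSpace ℝ (Fin n) => θ ξ i := by fun_prop
  exact hmeas _ hc

/-! ## Lipschitz test functions for abstract fields -/

/-- **The weak identity for abstract fields extends to Lipschitz test functions.** If bounded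
measurable fields `u, g_α` on the slab `(0,T) × ℝᵐ` and bounded measurable data `u₀` satisfy
`∫₀ᵀ∫ [∂ₜφ • u + ∑_α ∂_αφ • g_α] + ∫ φ(0,x) • u₀ = 0` for every `C¹` test function `φ`
(`IsTestFunction T φ`), then the same identity (slab integral, a.e. Fréchet derivatives) holds
for every Lipschitz `Φ` with compact support vanishing for `t ≥ T'`, `T' < T` (mollification and
dominated convergence, as in `IsWeakSolution.lipschitzTest`; BDS p. 8: "by an easy approximation
argument … holds for any test function which is just Lipschitz continuous"). [folklore] -/
theorem weakIdentity_lipschitz_of_fields {T : ℝ}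
    {u : ℝ × EuclideanSpace ℝ (Fin m) → EuclideanSpace ℝ (Fin n)}
    {g : Fin m → ℝ × EuclideanSpace ℝ (Fin m) → EuclideanSpace ℝ (Fin n)}
    {u₀ : EuclideanSpace ℝ (Fin m) → EuclideanSpace ℝ (Fin n)}
    (hu : AEStronglyMeasurable u (volume.restrict (Ioo 0 T ×ˢ univ)))
    (hg : ∀ α, AEStronglyMeasurable (g α) (volume.restrict (Ioo 0 T ×ˢ univ)))
    (hu₀ : AEStronglyMeasurable u₀ volume)
    {M : ℝ} (huM : ∀ᵐ p ∂(volume.restrict (Ioo 0 T ×ˢ univ)), ‖u p‖ ≤ M)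
    (hgM : ∀ α, ∀ᵐ p ∂(volume.restrict (Ioo 0 T ×ˢ univ)), ‖g α p‖ ≤ M)
    (hu₀M : ∀ x, ‖u₀ x‖ ≤ M)
    (hweak : ∀ φ : ℝ × EuclideanSpace ℝ (Fin m) → ℝ, IsTestFunction T φ →
      (∫ t in Ioo 0 T, ∫ x,
          (testTimeDeriv φ t x • u (t, x) + ∑ α : Fin m, testSpaceDeriv φ α t x • g α (t, x)))
        + ∫ x, φ (0, x) • u₀ x = 0)
    {Φ : ℝ × EuclideanSpace ℝ (Fin m) → ℝ} {K : ℝ≥0} (hΦ : LipschitzWith K Φ)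
    (hΦc : HasCompactSupport Φ) {T' : ℝ} (hT' : T' < T) (hΦT : ∀ t x, T' ≤ t → Φ (t, x) = 0) :
    (∫ p in Ioo 0 T ×ˢ univ, (fderiv ℝ Φ p (1, 0) • u p
        + ∑ α : Fin m, fderiv ℝ Φ p (0, EuclideanSpace.single α (1 : ℝ)) • g α p))
      + ∫ x, Φ (0, x) • u₀ x = 0 := by
  haveI : (volume : Measure (ℝ × EuclideanSpace ℝ (Fin m))).IsAddHaarMeasure :=
    Measure.prod.instIsAddHaarMeasure _ _
  obtain ⟨ρs, hr, hr2, hr1, -⟩ := exists_bumpSeq (V := ℝ × EuclideanSpace ℝ (Fin m))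
  have hlim := tendsto_pairing_mollify hu hg hu₀ huM hgM hu₀M hΦ hΦc hr hr2 hr1
  have hev : ∀ᶠ k in atTop, T' + (ρs k).rOut < T := by
    have : Tendsto (fun k => T' + (ρs k).rOut) atTop (𝓝 (T' + 0)) := hr.const_add T'
    rw [add_zero] at this
    exact this.eventually (gt_mem_nhds hT')
  have hzero : ∀ᶠ k in atTop,
      (∫ p in Ioo 0 T ×ˢ univ,
        (fderiv ℝ ((ρs k).normed volume ⋆[lsmul ℝ ℝ, volume] Φ) p (1, 0) • u p
          + ∑ α : Fin m, fderiv ℝ ((ρs k).normed volume ⋆[lsmul ℝ ℝ, volume] Φ) p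
              (0, EuclideanSpace.single α (1 : ℝ)) • g α p))
      + ∫ x, ((ρs k).normed volume ⋆[lsmul ℝ ℝ, volume] Φ) (0, x) • u₀ x = 0 := by
    filter_upwards [hev] with k hk
    have htest := isTestFunction_mollify (ρs k) hΦ hΦc hΦT (hr1 k) hk
    have hid := hweak _ htest
    have key := pairing_eq_setIntegral hu hg huM hgM htest.1 htest.2.1
    rw [key] at hid
    exact hid
  exact tendsto_nhds_unique hlim (tendsto_const_nhds.congr' (hzero.mono fun k hk => hk.symm))

/-- **The entropy inequality for abstract fields extends to nonnegative Lipschitz test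
functions.** Scalar companion of `weakIdentity_lipschitz_of_fields`: if bounded measurable
`e, r_α` on the slab and bounded measurable `e₀` satisfy
`0 ≤ ∫₀ᵀ∫ [∂ₜψ e + ∑_α ∂_αψ r_α] + ∫ ψ(0,x) e₀` for every nonnegative `C¹` test function `ψ`,
then the same holds for every nonnegative Lipschitz `Φ` with compact support vanishing for
`t ≥ T'`, `T' < T`. [folklore] -/
theorem entropyIneq_lipschitz_of_fields {T : ℝ}
    {e : ℝ × EuclideanSpace ℝ (Fin m) → ℝ} {r : Fin m → ℝ × EuclideanSpace ℝ (Fin m) → ℝ}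
    {e₀ : EuclideanSpace ℝ (Fin m) → ℝ}
    (he : AEStronglyMeasurable e (volume.restrict (Ioo 0 T ×ˢ univ)))
    (hr : ∀ α, AEStronglyMeasurable (r α) (volume.restrict (Ioo 0 T ×ˢ univ)))
    (he₀ : AEStronglyMeasurable e₀ volume)
    {M : ℝ} (heM : ∀ᵐ p ∂(volume.restrict (Ioo 0 T ×ˢ univ)), ‖e p‖ ≤ M)
    (hrM : ∀ α, ∀ᵐ p ∂(volume.restrict (Ioo 0 T ×ˢ univ)), ‖r α p‖ ≤ M)
    (he₀M : ∀ x, ‖e₀ x‖ ≤ M)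
    (hent : ∀ ψ : ℝ × EuclideanSpace ℝ (Fin m) → ℝ, IsTestFunction T ψ → (∀ p, 0 ≤ ψ p) →
      0 ≤ (∫ t in Ioo 0 T, ∫ x,
          (testTimeDeriv ψ t x * e (t, x) + ∑ α : Fin m, testSpaceDeriv ψ α t x * r α (t, x)))
        + ∫ x, ψ (0, x) * e₀ x)
    {Φ : ℝ × EuclideanSpace ℝ (Fin m) → ℝ} {K : ℝ≥0} (hΦ : LipschitzWith K Φ)
    (hΦc : HasCompactSupport Φ) (hΦnn : ∀ p, 0 ≤ Φ p) {T' : ℝ} (hT' : T' < T)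
    (hΦT : ∀ t x, T' ≤ t → Φ (t, x) = 0) :
    0 ≤ (∫ p in Ioo 0 T ×ˢ univ, (fderiv ℝ Φ p (1, 0) * e p
        + ∑ α : Fin m, fderiv ℝ Φ p (0, EuclideanSpace.single α (1 : ℝ)) * r α p))
      + ∫ x, Φ (0, x) * e₀ x := by
  haveI : (volume : Measure (ℝ × EuclideanSpace ℝ (Fin m))).IsAddHaarMeasure :=
    Measure.prod.instIsAddHaarMeasure _ _
  obtain ⟨ρs, hρ, hr2, hr1, -⟩ := exists_bumpSeq (V := ℝ × EuclideanSpace ℝ (Fin m))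
  have hlim := tendsto_pairing_mollify (W := ℝ) he hr he₀ heM hrM he₀M hΦ hΦc hρ hr2 hr1
  have hev : ∀ᶠ k in atTop, T' + (ρs k).rOut < T := by
    have : Tendsto (fun k => T' + (ρs k).rOut) atTop (𝓝 (T' + 0)) := hρ.const_add T'
    rw [add_zero] at this
    exact this.eventually (gt_mem_nhds hT')
  have hnn : ∀ᶠ k in atTop,
      0 ≤ (∫ p in Ioo 0 T ×ˢ univ,
        (fderiv ℝ ((ρs k).normed volume ⋆[lsmul ℝ ℝ, volume] Φ) p (1, 0) • e p
          + ∑ α : Fin m, fderiv ℝ ((ρs k).normed volume ⋆[lsmul ℝ ℝ, volume] Φ) p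
              (0, EuclideanSpace.single α (1 : ℝ)) • r α p))
      + ∫ x, ((ρs k).normed volume ⋆[lsmul ℝ ℝ, volume] Φ) (0, x) • e₀ x := by
    filter_upwards [hev] with k hk
    have htest := isTestFunction_mollify (ρs k) hΦ hΦc hΦT (hr1 k) hk
    have hid := hent _ htest (fun p => mollify_nonneg (ρs k) hΦnn p)
    have key := pairing_eq_setIntegral (W := ℝ) he hr heM hrM htest.1 htest.2.1
    simp only [smul_eq_mul] at key
    rw [key] at hid
    simpa only [smul_eq_mul] using hid
  have := ge_of_tendsto hlim hnn
  simpa only [smul_eq_mul] using this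

/-! ## The relative entropy inequality for abstract fields -/

set_option maxHeartbeats 1600000 in -- one long assembly proof (Dafermos (5.2.6)–(5.2.10))
/-- **The relative entropy inequality for abstract fields (BDS (5.3.10) = Dafermos (5.2.10),
equal initial data).** Let `G_α, η, q_α` be `C²` on `ℝⁿ` with `Dq_α = Dη DG_α`, `𝒟 ⊆ ℝⁿ` convex
compact, `Ū` a weak solution on `[0,T)` with its own `t = 0` slice as datum, values in `𝒟`, and
Lipschitz on the box `[0,T'] × B̄(0,R)`, `0 < T' < T`. Let `u, g_α` (vector) and `e, r_α`
(scalar) be measurable fields bounded on the slab `(0,T) × ℝᵐ` which satisfy the weak identity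
`∫∫ [∂ₜΦ • u + ∑_α ∂_αΦ • g_α] + ∫ Φ(0,·) • Ū(0,·) = 0` for Lipschitz compactly supported `Φ`
vanishing near `t = T`, and the entropy inequality
`0 ≤ ∫∫ [∂ₜΦ e + ∑_α ∂_αΦ r_α] + ∫ Φ(0,·) η(Ū(0,·))` for the nonnegative such `Φ` (for a
measure-valued solution: `u = ⟨ν,ξ⟩, g_α = ⟨ν,G_α⟩, e = ⟨ν,η⟩, r_α = ⟨ν,q_α⟩`). Then for every
nonnegative `C¹` test function `ψ` supported in `(-∞,T') × B(0,R)`, with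
`h = e - η(Ū) - Dη(Ū)[u - Ū]`, `Y_α = r_α - q_α(Ū) - Dη(Ū)[g_α - G_α(Ū)]`,
`Z_α = g_α - G_α(Ū) - DG_α(Ū)[u - Ū]`:
`∫_{(0,T)×ℝᵐ} ψ ∑_α D²η(Ū)[∂_αŪ, Z_α] ≤ ∫_{(0,T)×ℝᵐ} [Dψ(1,0) h + ∑_α Dψ(0,e_α) Y_α]`, both
integrands being integrable on the slab (BDS (5.3.6)–(5.3.10); proof verbatim that of
`relEntropy_ineq`, Dafermos (5.2.6)–(5.2.10)). [cite: BrenierDeLellisSzekelyhidi2011, Thm 3] -/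
theorem relEntropy_ineq_fields
    {G : Fin m → EuclideanSpace ℝ (Fin n) → EuclideanSpace ℝ (Fin n)}
    {η : EuclideanSpace ℝ (Fin n) → ℝ} {q : Fin m → EuclideanSpace ℝ (Fin n) → ℝ}
    (hG : ∀ α, ContDiff ℝ 2 (G α)) (hη : ContDiff ℝ 2 η) (hq : ∀ α, ContDiff ℝ 2 (q α))
    (hcompat : ∀ V α, fderiv ℝ (q α) V = (fderiv ℝ η V).comp (fderiv ℝ (G α) V))
    {D : Set (EuclideanSpace ℝ (Fin n))} (hDc : IsCompact D) (hDconv : Convex ℝ D)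
    {T : ℝ} {Ubar : ℝ → EuclideanSpace ℝ (Fin m) → EuclideanSpace ℝ (Fin n)}
    (hŪw : IsWeakSolution Set.univ G T Ubar (Ubar 0)) (hŪD : ∀ t ∈ Ico 0 T, ∀ x, Ubar t x ∈ D)
    {T' R : ℝ} (hT'0 : 0 < T') (hT' : T' < T) {K : ℝ≥0}
    (hK : LipschitzOnWith K (Function.uncurry Ubar) (Icc 0 T' ×ˢ closedBall 0 R))
    {uν : ℝ × EuclideanSpace ℝ (Fin m) → EuclideanSpace ℝ (Fin n)}
    {gν : Fin m → ℝ × EuclideanSpace ℝ (Fin m) → EuclideanSpace ℝ (Fin n)}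
    {ην : ℝ × EuclideanSpace ℝ (Fin m) → ℝ} {qν : Fin m → ℝ × EuclideanSpace ℝ (Fin m) → ℝ}
    (hum : AEStronglyMeasurable uν (volume.restrict (Ioo 0 T ×ˢ univ)))
    (hgm : ∀ α, AEStronglyMeasurable (gν α) (volume.restrict (Ioo 0 T ×ˢ univ)))
    (hηνm : AEStronglyMeasurable ην (volume.restrict (Ioo 0 T ×ˢ univ)))
    (hqνm : ∀ α, AEStronglyMeasurable (qν α) (volume.restrict (Ioo 0 T ×ˢ univ)))
    {Mν : ℝ} (huM : ∀ p ∈ Ioo 0 T ×ˢ (univ : Set (EuclideanSpace ℝ (Fin m))), ‖uν p‖ ≤ Mν)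
    (hgM : ∀ α, ∀ p ∈ Ioo 0 T ×ˢ (univ : Set (EuclideanSpace ℝ (Fin m))), ‖gν α p‖ ≤ Mν)
    (hηνM : ∀ p ∈ Ioo 0 T ×ˢ (univ : Set (EuclideanSpace ℝ (Fin m))), ‖ην p‖ ≤ Mν)
    (hqνM : ∀ α, ∀ p ∈ Ioo 0 T ×ˢ (univ : Set (EuclideanSpace ℝ (Fin m))), ‖qν α p‖ ≤ Mν)
    (hweak : ∀ (Φ : ℝ × EuclideanSpace ℝ (Fin m) → ℝ) (KΦ : ℝ≥0), LipschitzWith KΦ Φ →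
      HasCompactSupport Φ → ∀ T'' < T, (∀ t x, T'' ≤ t → Φ (t, x) = 0) →
      (∫ p in Ioo 0 T ×ˢ univ, (fderiv ℝ Φ p (1, 0) • uν p
          + ∑ α : Fin m, fderiv ℝ Φ p (0, EuclideanSpace.single α (1 : ℝ)) • gν α p))
        + ∫ x, Φ (0, x) • Ubar 0 x = 0)
    (hent : ∀ (Φ : ℝ × EuclideanSpace ℝ (Fin m) → ℝ) (KΦ : ℝ≥0), LipschitzWith KΦ Φ →
      HasCompactSupport Φ → (∀ p, 0 ≤ Φ p) → ∀ T'' < T, (∀ t x, T'' ≤ t → Φ (t, x) = 0) →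
      0 ≤ (∫ p in Ioo 0 T ×ˢ univ, (fderiv ℝ Φ p (1, 0) * ην p
          + ∑ α : Fin m, fderiv ℝ Φ p (0, EuclideanSpace.single α (1 : ℝ)) * qν α p))
        + ∫ x, Φ (0, x) * η (Ubar 0 x))
    {ψ : ℝ × EuclideanSpace ℝ (Fin m) → ℝ} (hψ : ContDiff ℝ 1 ψ) (hψc : HasCompactSupport ψ)
    (hψnn : ∀ p, 0 ≤ ψ p) (hψs : tsupport ψ ⊆ Iio T' ×ˢ ball (0 : EuclideanSpace ℝ (Fin m)) R) :
    Integrable (fun p : ℝ × EuclideanSpace ℝ (Fin m) => ψ p * ∑ α : Fin m,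
        fderiv ℝ (fderiv ℝ η) (Ubar p.1 p.2)
          (fderiv ℝ (Function.uncurry Ubar) p (0, EuclideanSpace.single α (1 : ℝ)))
          (gν α p - G α (Ubar p.1 p.2)
            - fderiv ℝ (G α) (Ubar p.1 p.2) (uν p - Ubar p.1 p.2)))
      (volume.restrict (Ioo 0 T ×ˢ univ)) ∧
    Integrable (fun p : ℝ × EuclideanSpace ℝ (Fin m) => fderiv ℝ ψ p (1, 0)
          * (ην p - η (Ubar p.1 p.2) - fderiv ℝ η (Ubar p.1 p.2) (uν p - Ubar p.1 p.2))
        + ∑ α : Fin m, fderiv ℝ ψ p (0, EuclideanSpace.single α (1 : ℝ))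
          * (qν α p - q α (Ubar p.1 p.2)
            - fderiv ℝ η (Ubar p.1 p.2) (gν α p - G α (Ubar p.1 p.2))))
      (volume.restrict (Ioo 0 T ×ˢ univ)) ∧
    ∫ p in Ioo 0 T ×ˢ univ, ψ p * ∑ α : Fin m, fderiv ℝ (fderiv ℝ η) (Ubar p.1 p.2)
        (fderiv ℝ (Function.uncurry Ubar) p (0, EuclideanSpace.single α (1 : ℝ)))
        (gν α p - G α (Ubar p.1 p.2)
          - fderiv ℝ (G α) (Ubar p.1 p.2) (uν p - Ubar p.1 p.2))
      ≤ ∫ p in Ioo 0 T ×ˢ univ, (fderiv ℝ ψ p (1, 0)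
          * (ην p - η (Ubar p.1 p.2) - fderiv ℝ η (Ubar p.1 p.2) (uν p - Ubar p.1 p.2))
        + ∑ α : Fin m, fderiv ℝ ψ p (0, EuclideanSpace.single α (1 : ℝ))
          * (qν α p - q α (Ubar p.1 p.2)
            - fderiv ℝ η (Ubar p.1 p.2) (gν α p - G α (Ubar p.1 p.2)))) := by
  classical
  haveI : (volume : Measure (ℝ × EuclideanSpace ℝ (Fin m))).IsAddHaarMeasure :=
    Measure.prod.instIsAddHaarMeasure _ _
  -- `O = univ`
  have hO : IsOpen (univ : Set (EuclideanSpace ℝ (Fin n))) := isOpen_univ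
  have hD : D ⊆ univ := subset_univ D
  have hTpos : 0 < T := hT'0.trans hT'
  -- smoothness levels
  have hG2 : ∀ α, ContDiffOn ℝ 2 (G α) univ := fun α => (hG α).contDiffOn
  have hG1 : ∀ α, ContDiffOn ℝ 1 (G α) univ := fun α => (hG2 α).of_le (by norm_num)
  have hη2 : ContDiffOn ℝ 2 η univ := hη.contDiffOn
  have hη1 : ContDiffOn ℝ 1 η univ := hη2.of_le (by norm_num)
  have hq2 : ∀ α, ContDiffOn ℝ 2 (q α) univ := fun α => (hq α).contDiffOn
  have hq1 : ∀ α, ContDiffOn ℝ 1 (q α) univ := fun α => (hq2 α).of_le (by norm_num)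
  have hGc : ∀ α, ContinuousOn (G α) univ := fun α => (hG α).continuous.continuousOn
  have hηc : ContinuousOn η univ := hη.continuous.continuousOn
  have hqc : ∀ α, ContinuousOn (q α) univ := fun α => (hq α).continuous.continuousOn
  have hcompat' : ∀ V ∈ (univ : Set (EuclideanSpace ℝ (Fin n))), ∀ α,
      fderiv ℝ (q α) V = (fderiv ℝ η V).comp (fderiv ℝ (G α) V) := fun V _ α => hcompat V α
  have hUnc : ∀ p : ℝ × EuclideanSpace ℝ (Fin m), Function.uncurry Ubar p = Ubar p.1 p.2 :=
    fun p => rfl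
  -- boxes and the slab
  set Bc : Set (ℝ × EuclideanSpace ℝ (Fin m)) := Icc 0 T' ×ˢ closedBall 0 R with hBc
  set Bo : Set (ℝ × EuclideanSpace ℝ (Fin m)) := Ioo 0 T' ×ˢ ball 0 R with hBo
  set S : Set (ℝ × EuclideanSpace ℝ (Fin m)) := Ioo 0 T ×ˢ univ with hSdef
  have hSm : MeasurableSet S := measurableSet_Ioo.prod MeasurableSet.univ
  have hBoBc : Bo ⊆ Bc := Set.prod_mono Ioo_subset_Icc_self ball_subset_closedBall
  have hBcD : ∀ p ∈ Bc, Function.uncurry Ubar p ∈ D := fun p hp =>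
    hŪD p.1 ⟨hp.1.1, lt_of_le_of_lt hp.1.2 hT'⟩ p.2
  have hBo_nhds : ∀ p ∈ Bo, Bc ∈ 𝓝 p := fun p hp =>
    Filter.mem_of_superset ((isOpen_Ioo.prod isOpen_ball).mem_nhds hp) hBoBc
  have hSD_Ū : ∀ p ∈ S, Ubar p.1 p.2 ∈ D := fun p hp => hŪD p.1 (Ioo_subset_Ico_self hp.1) p.2
  have hSmem : ∀ᵐ p ∂(volume.restrict S), p ∈ S := ae_restrict_mem hSm
  -- support facts for `ψ`
  have hψ_out : ∀ p : ℝ × EuclideanSpace ℝ (Fin m), p ∉ Iio T' ×ˢ ball (0 : EuclideanSpace ℝ (Fin m)) R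
      → ψ p = 0 := fun p hp => image_eq_zero_of_notMem_tsupport fun h => hp (hψs h)
  have hψT : ∀ t x, T' ≤ t → ψ (t, x) = 0 := fun t x ht =>
    hψ_out (t, x) fun h => not_lt.mpr ht h.1
  have hsupp_S : ∀ p ∈ tsupport ψ, p ∈ S → p ∈ Bo := fun p hp hs =>
    ⟨⟨hs.1.1, (hψs hp).1⟩, (hψs hp).2⟩
  have hDψ0 : ∀ p : ℝ × EuclideanSpace ℝ (Fin m), p ∉ tsupport ψ → fderiv ℝ ψ p = 0 := fun p hp =>
    fderiv_eq_zero_of_notMem_tsupport hp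
  obtain ⟨Kψ, hψlip⟩ := hψ.lipschitzWith_of_hasCompactSupport hψc one_ne_zero
  obtain ⟨Mψ, hMψ⟩ := hψ.continuous.bounded_above_of_compact_support hψc
  have hψd : Differentiable ℝ ψ := hψ.differentiable one_ne_zero
  have hDψcont : ∀ v, Continuous fun p => fderiv ℝ ψ p v := fun v =>
    (hψ.continuous_fderiv one_ne_zero).clm_apply continuous_const
  have hDψcs : ∀ v, HasCompactSupport fun p => fderiv ℝ ψ p v := fun v =>
    hψc.fderiv_apply (𝕜 := ℝ) v
  -- bounds over `D`
  obtain ⟨Mη, hMη⟩ : ∃ M : ℝ, ∀ V ∈ D, ‖η V‖ ≤ M :=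
    exists_norm_le_of_continuousOn hηc hD hDc
  have hMq : ∃ M : ℝ, ∀ α, ∀ V ∈ D, ‖q α V‖ ≤ M := by
    have h1 : ∀ α, ∃ M : ℝ, ∀ V ∈ D, ‖q α V‖ ≤ M := fun α =>
      exists_norm_le_of_continuousOn (hqc α) hD hDc
    choose Mα hMα using h1
    refine ⟨∑ α, |Mα α|, fun α V hV => (hMα α V hV).trans ((le_abs_self _).trans ?_)⟩
    exact Finset.single_le_sum (f := fun α => |Mα α|) (fun α _ => abs_nonneg _) (Finset.mem_univ α)
  obtain ⟨Mq, hMq⟩ := hMq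
  have hMG : ∃ M : ℝ, ∀ α, ∀ V ∈ D, ‖G α V‖ ≤ M := by
    have h1 : ∀ α, ∃ M : ℝ, ∀ V ∈ D, ‖G α V‖ ≤ M := fun α =>
      exists_norm_le_of_continuousOn (hGc α) hD hDc
    choose Mα hMα using h1
    refine ⟨∑ α, |Mα α|, fun α V hV => (hMα α V hV).trans ((le_abs_self _).trans ?_)⟩
    exact Finset.single_le_sum (f := fun α => |Mα α|) (fun α _ => abs_nonneg _) (Finset.mem_univ α)
  obtain ⟨MG, hMG⟩ := hMG
  have hMDG : ∃ M : ℝ, ∀ α, ∀ V ∈ D, ‖fderiv ℝ (G α) V‖ ≤ M := by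
    have h1 : ∀ α, ∃ M : ℝ, ∀ V ∈ D, ‖fderiv ℝ (G α) V‖ ≤ M := fun α => by
      obtain ⟨M, -, hM⟩ := exists_forall_norm_fderiv_le hO (hG1 α) hD hDc
      exact ⟨M, hM⟩
    choose Mα hMα using h1
    refine ⟨∑ α, |Mα α|, fun α V hV => (hMα α V hV).trans ((le_abs_self _).trans ?_)⟩
    exact Finset.single_le_sum (f := fun α => |Mα α|) (fun α _ => abs_nonneg _) (Finset.mem_univ α)
  obtain ⟨MDG, hMDG⟩ := hMDG
  obtain ⟨M1, hM1nn, hM1⟩ := exists_forall_norm_fderiv_le hO hη1 hD hDc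
  obtain ⟨M2, hM2nn, hM2⟩ := exists_forall_norm_fderiv_fderiv_le hO hη2 hD hDc
  obtain ⟨LDη, hLDη⟩ := exists_lipschitzOnWith_fderiv hO hη2 hD hDc hDconv
  -- data of the classical solution
  have hŪm : Measurable (Function.uncurry Ubar) := hŪw.1
  obtain ⟨CŪ, hŪC, -⟩ := hŪw.2.2.2.2.1
  have hGM_Ū : ∀ α, ∀ t ∈ Ioo 0 T, ∀ x, ‖G α (Ubar t x)‖ ≤ MG := fun α t ht x =>
    hMG α _ (hŪD t (Ioo_subset_Ico_self ht) x)
  set Mall : ℝ := max Mη Mq with hMall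
  ----------------------------------------------------------------
  -- Step (I): the entropy inequality of the fields tested with `ψ`
  ----------------------------------------------------------------
  have hI := hent ψ Kψ hψlip hψc hψnn T' hT' hψT
  ----------------------------------------------------------------
  -- Step (II): the entropy equality for `Ū`
  ----------------------------------------------------------------
  have hII := classical_entropy_eq hO hG1 hη1 hq1 hcompat' hD hDc hDconv hŪw hŪD hT'0 hT' hK hψ hψc
    hψs
  ----------------------------------------------------------------
  -- notation for directions (introduced now, so that `hI`, `hII` are rewritten too)
  ----------------------------------------------------------------
  set e₀ : ℝ × EuclideanSpace ℝ (Fin m) := (1, 0) with he₀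
  set e : Fin m → ℝ × EuclideanSpace ℝ (Fin m) :=
    fun α => (0, EuclideanSpace.single α (1 : ℝ)) with he
  set b : Fin n → EuclideanSpace ℝ (Fin n) := fun i => EuclideanSpace.single i (1 : ℝ) with hb
  have he₀n : ‖e₀‖ = 1 := norm_timeDir
  have hen : ∀ α, ‖e α‖ = 1 := fun α => norm_spaceDir α
  ----------------------------------------------------------------
  -- Step (III): the Lipschitz test functions `Φ_i = ψ ∂η/∂U_i(Ū)`
  ----------------------------------------------------------------
  have hwL : ∀ i, LipschitzOnWith (‖ContinuousLinearMap.apply ℝ ℝ (b i)‖₊ * LDη)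
      (fun V => fderiv ℝ η V (b i)) D := fun i => by
    have := (ContinuousLinearMap.apply ℝ ℝ (b i)).lipschitz.comp_lipschitzOnWith hLDη
    simpa [Function.comp_def] using this
  have hWex : ∀ i, ∃ Wt : ℝ × EuclideanSpace ℝ (Fin m) → ℝ, ∃ KW : ℝ≥0, LipschitzWith KW Wt ∧
      ∀ p ∈ Bc, Wt p = fderiv ℝ η (Function.uncurry Ubar p) (b i) := fun i =>
    exists_lipschitz_extension hK hBcD (hwL i)
  choose Wt KW hWlip hWeq using hWex
  set Φ : Fin n → ℝ × EuclideanSpace ℝ (Fin m) → ℝ := fun i p => ψ p * Wt i p with hΦdef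
  have hΦex : ∀ i, ∃ KΦ : ℝ≥0, LipschitzWith KΦ (Φ i) := fun i =>
    exists_lipschitzWith_mul hψlip hψc (hWlip i)
  choose KΦ hΦlip using hΦex
  have hΦc : ∀ i, HasCompactSupport (Φ i) := fun i => hψc.mul_right
  have hΦT : ∀ i, ∀ t x, T' ≤ t → Φ i (t, x) = 0 := by
    intro i t x ht
    simp only [hΦdef, hψT t x ht, zero_mul]
  have hΦsupp : ∀ i, tsupport (Φ i) ⊆ tsupport ψ := fun i => tsupport_mul_subset_left
  have hDΦ0 : ∀ i (p : ℝ × EuclideanSpace ℝ (Fin m)), p ∉ tsupport ψ → fderiv ℝ (Φ i) p = 0 :=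
    fun i p hp => fderiv_eq_zero_of_notMem_tsupport fun h => hp (hΦsupp i h)
  have hDΦbd : ∀ i p v, ‖fderiv ℝ (Φ i) p v‖ ≤ KΦ i * ‖v‖ := fun i p v => by
    rw [Real.norm_eq_abs]; exact abs_fderiv_apply_le_of_lipschitz (hΦlip i) p v
  -- the two weak formulations tested with `Φ_i`
  -- the two weak formulations tested with `Φ_i`
  have hWU : ∀ i, (∫ p in S, (fderiv ℝ (Φ i) p e₀ • uν p
        + ∑ α : Fin m, fderiv ℝ (Φ i) p (e α) • gν α p))
      + ∫ x, Φ i (0, x) • Ubar 0 x = 0 := fun i =>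
    hweak (Φ i) (KΦ i) (hΦlip i) (hΦc i) T' hT' (hΦT i)
  have hWŪ : ∀ i, (∫ p in S, (fderiv ℝ (Φ i) p e₀ • Ubar p.1 p.2
        + ∑ α : Fin m, fderiv ℝ (Φ i) p (e α) • G α (Ubar p.1 p.2)))
      + ∫ x, Φ i (0, x) • Ubar 0 x = 0 := fun i =>
    IsWeakSolution.lipschitzTest hŪw hGM_Ū (hΦlip i) (hΦc i) hT' (hΦT i)
  -- measurability of the fields on the slab
  have hu_Ū : AEStronglyMeasurable (fun p : ℝ × EuclideanSpace ℝ (Fin m) => Ubar p.1 p.2)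
      (volume.restrict S) := hŪm.aestronglyMeasurable
  have hg_Ū : ∀ α, AEStronglyMeasurable (fun p : ℝ × EuclideanSpace ℝ (Fin m) => G α (Ubar p.1 p.2))
      (volume.restrict S) := fun α =>
    aestronglyMeasurable_comp_slab (θ := G α)
      (V := fun p : ℝ × EuclideanSpace ℝ (Fin m) => Ubar p.1 p.2) hO
      (hGc α) hSm hŪm (fun p hp => hD (hSD_Ū p hp))
  have hDΦm : ∀ i v, AEStronglyMeasurable (fun p => fderiv ℝ (Φ i) p v) (volume.restrict S) :=
    fun i v => (measurable_fderiv_apply (Φ i) v).aestronglyMeasurable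
  -- integrability of the vector integrands
  have hintv : ∀ (i) (Uf : ℝ × EuclideanSpace ℝ (Fin m) → EuclideanSpace ℝ (Fin n))
      (Gf : Fin m → ℝ × EuclideanSpace ℝ (Fin m) → EuclideanSpace ℝ (Fin n)) (C : ℝ),
      AEStronglyMeasurable Uf (volume.restrict S) →
      (∀ α, AEStronglyMeasurable (Gf α) (volume.restrict S)) →
      (∀ p ∈ S, ‖Uf p‖ ≤ C) → (∀ α, ∀ p ∈ S, ‖Gf α p‖ ≤ C) →
      Integrable (fun p => fderiv ℝ (Φ i) p e₀ • Uf p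
        + ∑ α : Fin m, fderiv ℝ (Φ i) p (e α) • Gf α p) (volume.restrict S) := by
    intro i Uf Gf C hUf hGf hUfC hGfC
    have hC : 0 ≤ C ∨ S = ∅ := by
      by_cases hSe : S = ∅
      · exact Or.inr hSe
      · obtain ⟨p, hp⟩ := Set.nonempty_iff_ne_empty.2 hSe
        exact Or.inl ((norm_nonneg _).trans (hUfC p hp))
    refine Integrable.add ?_ (integrable_finsetSum _ fun α _ => ?_)
    · refine integrable_restrict_of_norm_le_of_eq_zero hSm hψc.isCompact
        ((hDΦm i e₀).smul hUf) (M := KΦ i * ‖e₀‖ * |C|) ?_ fun p hp => ?_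
      · filter_upwards [hSmem] with p hp
        rw [norm_smul]
        exact mul_le_mul (hDΦbd i p e₀) ((hUfC p hp).trans (le_abs_self _)) (norm_nonneg _)
          (by positivity)
      · rw [hDΦ0 i p hp]; simp
    · refine integrable_restrict_of_norm_le_of_eq_zero hSm hψc.isCompact
        ((hDΦm i (e α)).smul (hGf α)) (M := KΦ i * ‖e α‖ * |C|) ?_ fun p hp => ?_
      · filter_upwards [hSmem] with p hp
        rw [norm_smul]
        exact mul_le_mul (hDΦbd i p (e α)) ((hGfC α p hp).trans (le_abs_self _)) (norm_nonneg _)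
          (by positivity)
      · rw [hDΦ0 i p hp]; simp
  have hint_U : ∀ i, Integrable (fun p => fderiv ℝ (Φ i) p e₀ • uν p
      + ∑ α : Fin m, fderiv ℝ (Φ i) p (e α) • gν α p) (volume.restrict S) := fun i =>
    hintv i _ _ (max Mν MG) hum hgm
      (fun p hp => (huM p hp).trans (le_max_left _ _))
      (fun α p hp => (hgM α p hp).trans (le_max_left _ _))
  have hint_Ū : ∀ i, Integrable (fun p => fderiv ℝ (Φ i) p e₀ • Ubar p.1 p.2
      + ∑ α : Fin m, fderiv ℝ (Φ i) p (e α) • G α (Ubar p.1 p.2)) (volume.restrict S) := fun i =>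
    hintv i _ _ (max CŪ MG) hu_Ū hg_Ū
      (fun p hp => (hŪC p.1 (Ioo_subset_Ico_self hp.1) p.2).trans (le_max_left _ _))
      (fun α p hp => (hGM_Ū α p.1 hp.1 p.2).trans (le_max_right _ _))
  -- the difference of the two weak formulations
  set dv : Fin n → ℝ × EuclideanSpace ℝ (Fin m) → EuclideanSpace ℝ (Fin n) := fun i p =>
    fderiv ℝ (Φ i) p e₀ • (uν p - Ubar p.1 p.2)
      + ∑ α : Fin m, fderiv ℝ (Φ i) p (e α) • (gν α p - G α (Ubar p.1 p.2)) with hdv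
  have hdv_eq : ∀ i p, dv i p = (fderiv ℝ (Φ i) p e₀ • uν p
        + ∑ α : Fin m, fderiv ℝ (Φ i) p (e α) • gν α p)
      - (fderiv ℝ (Φ i) p e₀ • Ubar p.1 p.2
        + ∑ α : Fin m, fderiv ℝ (Φ i) p (e α) • G α (Ubar p.1 p.2)) := by
    intro i p
    simp only [hdv, smul_sub, Finset.sum_sub_distrib]
    abel
  have hint_dv : ∀ i, Integrable (dv i) (volume.restrict S) := fun i =>
    ((hint_U i).sub (hint_Ū i)).congr (ae_of_all _ fun p => (hdv_eq i p).symm)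
  have hdv0 : ∀ i, ∫ p in S, dv i p = 0 := by
    intro i
    have h1 := eq_neg_of_add_eq_zero_left (hWU i)
    have h2 := eq_neg_of_add_eq_zero_left (hWŪ i)
    calc ∫ p in S, dv i p
        = (∫ p in S, (fderiv ℝ (Φ i) p e₀ • uν p
            + ∑ α : Fin m, fderiv ℝ (Φ i) p (e α) • gν α p))
          - ∫ p in S, (fderiv ℝ (Φ i) p e₀ • Ubar p.1 p.2
            + ∑ α : Fin m, fderiv ℝ (Φ i) p (e α) • G α (Ubar p.1 p.2)) := by
          rw [← integral_sub (hint_U i) (hint_Ū i)]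
          exact integral_congr_ae (ae_of_all _ fun p => hdv_eq i p)
      _ = 0 := by rw [h1, h2, sub_self]
  -- coordinates, summed over `i`
  set cd : ℝ × EuclideanSpace ℝ (Fin m) → ℝ := fun p => ∑ i : Fin n,
    (fderiv ℝ (Φ i) p e₀ * (uν p - Ubar p.1 p.2) i
      + ∑ α : Fin m, fderiv ℝ (Φ i) p (e α) * (gν α p - G α (Ubar p.1 p.2)) i) with hcd
  have hcd_i : ∀ i p, (EuclideanSpace.proj i : EuclideanSpace ℝ (Fin n) →L[ℝ] ℝ) (dv i p)
      = fderiv ℝ (Φ i) p e₀ * (uν p - Ubar p.1 p.2) i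
        + ∑ α : Fin m, fderiv ℝ (Φ i) p (e α) * (gν α p - G α (Ubar p.1 p.2)) i := by
    intro i p
    simp [hdv, Finset.sum_apply]
  have hint_cdi : ∀ i, Integrable (fun p => fderiv ℝ (Φ i) p e₀ * (uν p - Ubar p.1 p.2) i
      + ∑ α : Fin m, fderiv ℝ (Φ i) p (e α) * (gν α p - G α (Ubar p.1 p.2)) i)
      (volume.restrict S) := fun i =>
    (((EuclideanSpace.proj i : EuclideanSpace ℝ (Fin n) →L[ℝ] ℝ)).integrable_comp (hint_dv i)).congr
      (ae_of_all _ fun p => hcd_i i p)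
  have hint_cd : Integrable cd (volume.restrict S) := by
    simp only [hcd]
    exact integrable_finsetSum _ fun i _ => hint_cdi i
  have hcd0 : ∫ p in S, cd p = 0 := by
    simp only [hcd]
    rw [integral_finsetSum _ fun i _ => hint_cdi i]
    refine Finset.sum_eq_zero fun i _ => ?_
    have h1 := (EuclideanSpace.proj i : EuclideanSpace ℝ (Fin n) →L[ℝ] ℝ).integral_comp_comm (hint_dv i)
    rw [hdv0 i, map_zero] at h1
    rw [← h1]
    exact integral_congr_ae (ae_of_all _ fun p => (hcd_i i p).symm)
  ----------------------------------------------------------------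
  -- Step (IV): the pointwise identity `cd = Cterm + ψ g` a.e. on the slab
  ----------------------------------------------------------------
  set Cterm : ℝ × EuclideanSpace ℝ (Fin m) → ℝ := fun p =>
    fderiv ℝ ψ p e₀ * fderiv ℝ η (Ubar p.1 p.2) (uν p - Ubar p.1 p.2)
      + ∑ α : Fin m, fderiv ℝ ψ p (e α)
          * fderiv ℝ η (Ubar p.1 p.2) (gν α p - G α (Ubar p.1 p.2)) with hCterm
  set g : ℝ × EuclideanSpace ℝ (Fin m) → ℝ := fun p => ∑ α : Fin m,
    fderiv ℝ (fderiv ℝ η) (Ubar p.1 p.2)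
      (fderiv ℝ (Function.uncurry Ubar) p (e α))
      (gν α p - G α (Ubar p.1 p.2)
        - fderiv ℝ (G α) (Ubar p.1 p.2) (uν p - Ubar p.1 p.2)) with hg
  have hpde := classical_ae_pde hO hG1 hD hDc hDconv hŪw hŪD hT' hK
  have hη2d : ∀ V ∈ D, DifferentiableAt ℝ (fderiv ℝ η) V := fun V hV =>
    (differentiableAt_of_contDiffOn_two hO hη2 (hD hV)).2
  have hident : ∀ᵐ p ∂(volume.restrict S), cd p = Cterm p + ψ p * g p := by
    filter_upwards [hSmem, ae_restrict_of_ae (s := S) hpde] with p hpS hp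
    by_cases hps : p ∈ tsupport ψ
    · -- on the support: `p ∈ Bo`, `Ū` differentiable at `p`, the system holds at `p`
      have hpo : p ∈ Bo := hsupp_S p hps hpS
      have hpc : p ∈ Bc := hBoBc hpo
      obtain ⟨hd, hsysp⟩ := hp hpo
      have hpD : Function.uncurry Ubar p ∈ D := hBcD p hpc
      -- derivative of `Wt i` at `p`
      have hw_fd : ∀ i, HasFDerivAt (fun V : EuclideanSpace ℝ (Fin n) => fderiv ℝ η V (b i))
          ((ContinuousLinearMap.apply ℝ ℝ (b i)).comp (fderiv ℝ (fderiv ℝ η) (Function.uncurry Ubar p)))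
          (Function.uncurry Ubar p) := fun i =>
        (ContinuousLinearMap.apply ℝ ℝ (b i)).hasFDerivAt.comp _ (hη2d _ hpD).hasFDerivAt
      have hWt_fd : ∀ i, HasFDerivAt (Wt i)
          (((ContinuousLinearMap.apply ℝ ℝ (b i)).comp
            (fderiv ℝ (fderiv ℝ η) (Function.uncurry Ubar p))).comp
            (fderiv ℝ (Function.uncurry Ubar) p)) p := by
        intro i
        have h1 := hasFDerivAt_extension (θ := fun V => fderiv ℝ η V (b i)) (hWeq i) hpo hd
          (hw_fd i).differentiableAt
        rw [(hw_fd i).fderiv] at h1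
        exact h1
      -- derivative of `Φ i = ψ * Wt i` at `p`
      have hΦ_fd : ∀ i v, fderiv ℝ (Φ i) p v
          = fderiv ℝ ψ p v * fderiv ℝ η (Function.uncurry Ubar p) (b i)
            + ψ p * fderiv ℝ (fderiv ℝ η) (Function.uncurry Ubar p)
                (fderiv ℝ (Function.uncurry Ubar) p v) (b i) := by
        intro i v
        have h1 := ((hψd p).hasFDerivAt.mul (hWt_fd i)).fderiv
        have h2 : fderiv ℝ (Φ i) p = fderiv ℝ (ψ * Wt i) p := rfl
        rw [h2, h1]
        simp only [add_apply, smul_apply, ContinuousLinearMap.comp_apply,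
          ContinuousLinearMap.apply_apply, smul_eq_mul, hWeq i p hpc]
        ring
      -- expand the sum over `i`
      have hexp : ∀ (v : ℝ × EuclideanSpace ℝ (Fin m)) (X : EuclideanSpace ℝ (Fin n)),
          ∑ i : Fin n, fderiv ℝ (Φ i) p v * X i
            = fderiv ℝ ψ p v * fderiv ℝ η (Function.uncurry Ubar p) X
              + ψ p * fderiv ℝ (fderiv ℝ η) (Function.uncurry Ubar p)
                  (fderiv ℝ (Function.uncurry Ubar) p v) X := by
        intro v X
        simp_rw [hΦ_fd, add_mul, Finset.sum_add_distrib, mul_assoc, ← Finset.mul_sum]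
        rw [sum_apply_single_mul, sum_apply_single_mul]
      -- the system at `p`, and the symmetry (4.3.2)
      have hUt : fderiv ℝ (Function.uncurry Ubar) p e₀
          = -∑ α : Fin m, fderiv ℝ (G α) (Function.uncurry Ubar p)
              (fderiv ℝ (Function.uncurry Ubar) p (e α)) := eq_neg_of_add_eq_zero_left hsysp
      have hsym : ∀ α (a c : EuclideanSpace ℝ (Fin n)),
          fderiv ℝ (fderiv ℝ η) (Function.uncurry Ubar p) (fderiv ℝ (G α) (Function.uncurry Ubar p) a) c
            = fderiv ℝ (fderiv ℝ η) (Function.uncurry Ubar p) a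
                (fderiv ℝ (G α) (Function.uncurry Ubar p) c) := by
        intro α a c
        rw [fderiv_fderiv_symm hO hη2 (hD hpD), fderiv_fderiv_apply_fderiv_symm hO hη2 (hG2 α)
          (hq2 α) (fun V _ => hcompat V α) (hD hpD)]
      have htime : fderiv ℝ (fderiv ℝ η) (Function.uncurry Ubar p)
          (fderiv ℝ (Function.uncurry Ubar) p e₀) (uν p - Ubar p.1 p.2)
          = -∑ α : Fin m, fderiv ℝ (fderiv ℝ η) (Function.uncurry Ubar p)
              (fderiv ℝ (Function.uncurry Ubar) p (e α))
              (fderiv ℝ (G α) (Function.uncurry Ubar p) (uν p - Ubar p.1 p.2)) := by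
        rw [hUt, map_neg, map_sum, neg_apply, sum_apply]
        congr 1
        exact Finset.sum_congr rfl fun α _ => hsym α _ _
      -- conclude the pointwise identity
      have hswap : ∑ i : Fin n, ∑ α : Fin m, fderiv ℝ (Φ i) p (e α)
            * (gν α p - G α (Ubar p.1 p.2)) i
          = ∑ α : Fin m, ∑ i : Fin n, fderiv ℝ (Φ i) p (e α)
            * (gν α p - G α (Ubar p.1 p.2)) i := Finset.sum_comm
      have hcd_p : cd p
          = (fderiv ℝ ψ p e₀ * fderiv ℝ η (Function.uncurry Ubar p) (uν p - Ubar p.1 p.2)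
              + ψ p * fderiv ℝ (fderiv ℝ η) (Function.uncurry Ubar p)
                  (fderiv ℝ (Function.uncurry Ubar) p e₀) (uν p - Ubar p.1 p.2))
            + ∑ α : Fin m, (fderiv ℝ ψ p (e α)
                * fderiv ℝ η (Function.uncurry Ubar p) (gν α p - G α (Ubar p.1 p.2))
              + ψ p * fderiv ℝ (fderiv ℝ η) (Function.uncurry Ubar p)
                  (fderiv ℝ (Function.uncurry Ubar) p (e α))
                  (gν α p - G α (Ubar p.1 p.2))) := by
        simp only [hcd]
        rw [Finset.sum_add_distrib, hswap, hexp]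
        simp_rw [hexp]
      have hg_p : ψ p * g p = ∑ α : Fin m,
          (ψ p * fderiv ℝ (fderiv ℝ η) (Ubar p.1 p.2) (fderiv ℝ (Function.uncurry Ubar) p (e α))
              (gν α p - G α (Ubar p.1 p.2))
            - ψ p * fderiv ℝ (fderiv ℝ η) (Ubar p.1 p.2) (fderiv ℝ (Function.uncurry Ubar) p (e α))
              (fderiv ℝ (G α) (Ubar p.1 p.2) (uν p - Ubar p.1 p.2))) := by
        simp only [hg, Finset.mul_sum, map_sub, mul_sub]
      rw [hcd_p, hg_p, htime]
      simp only [hCterm, hUnc, mul_neg, Finset.mul_sum, Finset.sum_add_distrib,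
        Finset.sum_sub_distrib]
      ring
    · -- off the support everything vanishes
      have h0 : ψ p = 0 := image_eq_zero_of_notMem_tsupport hps
      simp only [hcd, hCterm, hDΦ0 _ p hps, hDψ0 p hps, h0, zero_apply,
        zero_mul, Finset.sum_const_zero, add_zero]
  ----------------------------------------------------------------
  -- integrability of `Cterm`, `ψ g`, and of the entropy integrands
  ----------------------------------------------------------------
  have hDη_m := aestronglyMeasurable_comp_slab (θ := fderiv ℝ η)
      (V := fun p : ℝ × EuclideanSpace ℝ (Fin m) => Ubar p.1 p.2) hO
      (hη1.continuousOn_fderiv_of_isOpen hO le_rfl) hSm hŪm (fun p hp => hD (hSD_Ū p hp))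
  have hD2η_m := aestronglyMeasurable_comp_slab (θ := fderiv ℝ (fderiv ℝ η))
      (V := fun p : ℝ × EuclideanSpace ℝ (Fin m) => Ubar p.1 p.2) hO
      ((hη2.fderiv_of_isOpen hO le_rfl).continuousOn_fderiv_of_isOpen hO le_rfl) hSm hŪm
      (fun p hp => hD (hSD_Ū p hp))
  have hDG_m := fun α => aestronglyMeasurable_comp_slab (θ := fderiv ℝ (G α))
      (V := fun p : ℝ × EuclideanSpace ℝ (Fin m) => Ubar p.1 p.2) hO
      ((hG1 α).continuousOn_fderiv_of_isOpen hO le_rfl) hSm hŪm (fun p hp => hD (hSD_Ū p hp))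
  have hη_mŪ : AEStronglyMeasurable (fun p : ℝ × EuclideanSpace ℝ (Fin m) => η (Ubar p.1 p.2))
      (volume.restrict S) :=
    aestronglyMeasurable_comp_slab (θ := η)
      (V := fun p : ℝ × EuclideanSpace ℝ (Fin m) => Ubar p.1 p.2) hO
      hηc hSm hŪm (fun p hp => hD (hSD_Ū p hp))
  have hq_mŪ : ∀ α, AEStronglyMeasurable (fun p : ℝ × EuclideanSpace ℝ (Fin m) => q α (Ubar p.1 p.2))
      (volume.restrict S) := fun α =>
    aestronglyMeasurable_comp_slab (θ := q α)
      (V := fun p : ℝ × EuclideanSpace ℝ (Fin m) => Ubar p.1 p.2) hO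
      (hqc α) hSm hŪm (fun p hp => hD (hSD_Ū p hp))
  -- a scalar bounded a.e.-measurable factor times a continuous compactly supported prefactor
  have hprod : ∀ (c : ℝ × EuclideanSpace ℝ (Fin m) → ℝ) (w : ℝ × EuclideanSpace ℝ (Fin m) → ℝ) (M : ℝ),
      Continuous c → HasCompactSupport c → AEStronglyMeasurable w (volume.restrict S) →
      (∀ p ∈ S, ‖w p‖ ≤ M) → Integrable (fun p => c p * w p) (volume.restrict S) := by
    intro c w M hc hcs hw hwM
    have := integrable_smul_of_norm_le (μ := volume.restrict S) hc hcs hw (M := M)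
      (by filter_upwards [hSmem] with p hp; exact hwM p hp)
    simpa only [smul_eq_mul] using this
  -- `Cterm`
  have hC1m : AEStronglyMeasurable (fun p : ℝ × EuclideanSpace ℝ (Fin m) =>
      fderiv ℝ η (Ubar p.1 p.2) (uν p - Ubar p.1 p.2)) (volume.restrict S) := by
    have := ContinuousLinearMap.aestronglyMeasurable_comp₂ (ContinuousLinearMap.id ℝ _) hDη_m
      (hum.sub hu_Ū)
    simpa only [ContinuousLinearMap.coe_id', id_eq, Pi.sub_apply] using this
  have hC2m : ∀ α, AEStronglyMeasurable (fun p : ℝ × EuclideanSpace ℝ (Fin m) =>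
      fderiv ℝ η (Ubar p.1 p.2) (gν α p - G α (Ubar p.1 p.2))) (volume.restrict S) := by
    intro α
    have := ContinuousLinearMap.aestronglyMeasurable_comp₂ (ContinuousLinearMap.id ℝ _) hDη_m
      ((hgm α).sub (hg_Ū α))
    simpa only [ContinuousLinearMap.coe_id', id_eq, Pi.sub_apply] using this
  have hC1b : ∀ p ∈ S, ‖fderiv ℝ η (Ubar p.1 p.2) (uν p - Ubar p.1 p.2)‖ ≤ M1 * (Mν + CŪ) := by
    intro p hp
    refine (le_opNorm _ _).trans (mul_le_mul (hM1 _ (hSD_Ū p hp)) ((norm_sub_le _ _).trans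
      (add_le_add (huM p hp) (hŪC p.1 (Ioo_subset_Ico_self hp.1) p.2)))
      (norm_nonneg _) hM1nn)
  have hC2b : ∀ α, ∀ p ∈ S, ‖fderiv ℝ η (Ubar p.1 p.2) (gν α p - G α (Ubar p.1 p.2))‖
      ≤ M1 * (Mν + MG) := by
    intro α p hp
    refine (le_opNorm _ _).trans (mul_le_mul (hM1 _ (hSD_Ū p hp)) ((norm_sub_le _ _).trans
      (add_le_add (hgM α p hp) (hGM_Ū α p.1 hp.1 p.2))) (norm_nonneg _) hM1nn)
  have hCint1 : Integrable (fun p => fderiv ℝ ψ p e₀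
      * fderiv ℝ η (Ubar p.1 p.2) (uν p - Ubar p.1 p.2)) (volume.restrict S) :=
    hprod _ _ _ (hDψcont e₀) (hDψcs e₀) hC1m hC1b
  have hCint2 : ∀ α, Integrable (fun p => fderiv ℝ ψ p (e α)
      * fderiv ℝ η (Ubar p.1 p.2) (gν α p - G α (Ubar p.1 p.2))) (volume.restrict S) :=
    fun α => hprod _ _ _ (hDψcont (e α)) (hDψcs (e α)) (hC2m α) (hC2b α)
  have hCint : Integrable Cterm (volume.restrict S) := by
    simp only [hCterm]
    exact hCint1.add (integrable_finsetSum _ fun α _ => hCint2 α)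
  -- `ψ g`
  have hZm : ∀ α, AEStronglyMeasurable (fun p : ℝ × EuclideanSpace ℝ (Fin m) =>
      gν α p - G α (Ubar p.1 p.2)
        - fderiv ℝ (G α) (Ubar p.1 p.2) (uν p - Ubar p.1 p.2)) (volume.restrict S) := by
    intro α
    have := ContinuousLinearMap.aestronglyMeasurable_comp₂ (ContinuousLinearMap.id ℝ _) (hDG_m α)
      (hum.sub hu_Ū)
    simp only [ContinuousLinearMap.coe_id', id_eq, Pi.sub_apply] at this
    exact ((hgm α).sub (hg_Ū α)).sub this
  have hdŪm : ∀ α, AEStronglyMeasurable (fun p : ℝ × EuclideanSpace ℝ (Fin m) =>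
      fderiv ℝ (Function.uncurry Ubar) p (e α)) (volume.restrict S) := fun α =>
    (measurable_fderiv_apply_const ℝ (Function.uncurry Ubar) (e α)).aestronglyMeasurable
  have hgfm : AEStronglyMeasurable g (volume.restrict S) := by
    simp only [hg]
    refine Finset.aestronglyMeasurable_fun_sum _ fun α _ => ?_
    -- `(V, a, c) ↦ D²η(V)[a, c]` is continuous on `O × ℝⁿ × ℝⁿ`
    have hcont : ContinuousOn (fun z : EuclideanSpace ℝ (Fin n) × (EuclideanSpace ℝ (Fin n)
        × EuclideanSpace ℝ (Fin n)) => fderiv ℝ (fderiv ℝ η) z.1 z.2.1 z.2.2) ((univ : Set (EuclideanSpace ℝ (Fin n))) ×ˢ univ) := by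
      have h1 : ContinuousOn (fun z : EuclideanSpace ℝ (Fin n) × (EuclideanSpace ℝ (Fin n)
          × EuclideanSpace ℝ (Fin n)) => fderiv ℝ (fderiv ℝ η) z.1) ((univ : Set (EuclideanSpace ℝ (Fin n))) ×ˢ univ) :=
        ((hη2.fderiv_of_isOpen hO le_rfl).continuousOn_fderiv_of_isOpen hO le_rfl).comp
          continuous_fst.continuousOn (fun z hz => hz.1)
      exact (h1.clm_apply (continuous_snd.fst.continuousOn)).clm_apply continuous_snd.snd.continuousOn
    have hV : AEStronglyMeasurable (fun p : ℝ × EuclideanSpace ℝ (Fin m) => (Ubar p.1 p.2,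
        (fderiv ℝ (Function.uncurry Ubar) p (e α), gν α p - G α (Ubar p.1 p.2)
          - fderiv ℝ (G α) (Ubar p.1 p.2) (uν p - Ubar p.1 p.2)))) (volume.restrict S) :=
      hu_Ū.prodMk ((hdŪm α).prodMk (hZm α))
    exact aestronglyMeasurable_comp_of_continuousOn (hO.measurableSet.prod MeasurableSet.univ)
      hcont hV ((ae_restrict_mem hSm).mono fun p hp => ⟨hD (hSD_Ū p hp), mem_univ _⟩)
  -- bound for `ψ g`: only points of `tsupport ψ ∩ S ⊆ Bo` matter, where `‖∂_αŪ‖ ≤ K`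
  have hdŪb : ∀ p ∈ Bo, ∀ α, ‖fderiv ℝ (Function.uncurry Ubar) p (e α)‖ ≤ K := by
    intro p hp α
    refine (le_opNorm _ _).trans ?_
    rw [hen, mul_one]
    exact norm_fderiv_le_of_lipschitzOn ℝ (hBo_nhds p hp) hK
  set MZ : ℝ := max (Mν + MG + MDG * (Mν + CŪ)) 0 with hMZ
  have hMZnn : 0 ≤ MZ := le_max_right _ _
  have hZb : ∀ α, ∀ p ∈ S, ‖gν α p - G α (Ubar p.1 p.2)
      - fderiv ℝ (G α) (Ubar p.1 p.2) (uν p - Ubar p.1 p.2)‖ ≤ MZ := by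
    intro α p hp
    refine le_trans ?_ (le_max_left _ _)
    refine (norm_sub_le _ _).trans (add_le_add ((norm_sub_le _ _).trans (add_le_add
      (hgM α p hp) (hGM_Ū α p.1 hp.1 p.2))) ((le_opNorm _ _).trans (mul_le_mul
      (hMDG α _ (hSD_Ū p hp)) ((norm_sub_le _ _).trans (add_le_add
      (huM p hp) (hŪC p.1 (Ioo_subset_Ico_self hp.1) p.2)))
      (norm_nonneg _) ((norm_nonneg _).trans (hMDG α _ (hSD_Ū p hp))))))
  have hKnn : (0 : ℝ) ≤ K := K.2
  have hMψnn : 0 ≤ Mψ := (norm_nonneg _).trans (hMψ 0)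
  have hψgb : ∀ᵐ p ∂(volume.restrict S), ‖ψ p * g p‖ ≤ Mψ * (∑ _α : Fin m, M2 * K * MZ) := by
    filter_upwards [hSmem] with p hpS
    by_cases hps : p ∈ tsupport ψ
    · have hpo : p ∈ Bo := hsupp_S p hps hpS
      rw [norm_mul]
      refine mul_le_mul (hMψ p) ?_ (norm_nonneg _) ((norm_nonneg _).trans (hMψ p))
      simp only [hg]
      refine (norm_sum_le _ _).trans (Finset.sum_le_sum fun α _ => ?_)
      refine (le_opNorm _ _).trans (mul_le_mul ((le_opNorm _ _).trans (mul_le_mul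
        (hM2 _ (hSD_Ū p hpS)) (hdŪb p hpo α) (norm_nonneg _) hM2nn)) (hZb α p hpS)
        (norm_nonneg _) (mul_nonneg hM2nn hKnn))
    · have h0 : ψ p = 0 := image_eq_zero_of_notMem_tsupport hps
      rw [h0, zero_mul, norm_zero]
      exact mul_nonneg hMψnn (Finset.sum_nonneg fun α _ =>
        mul_nonneg (mul_nonneg hM2nn hKnn) hMZnn)
  have hψgint : Integrable (fun p => ψ p * g p) (volume.restrict S) :=
    integrable_restrict_of_norm_le_of_eq_zero hSm hψc.isCompact
      (hψ.continuous.aestronglyMeasurable.mul hgfm) hψgb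
      (fun p hp => by rw [image_eq_zero_of_notMem_tsupport hp, zero_mul])
  -- the entropy integrands
  set FU : ℝ × EuclideanSpace ℝ (Fin m) → ℝ := fun p =>
    fderiv ℝ ψ p e₀ * ην p + ∑ α : Fin m, fderiv ℝ ψ p (e α) * qν α p with hFU
  set FŪ : ℝ × EuclideanSpace ℝ (Fin m) → ℝ := fun p =>
    fderiv ℝ ψ p e₀ * η (Ubar p.1 p.2) + ∑ α : Fin m, fderiv ℝ ψ p (e α) * q α (Ubar p.1 p.2)
    with hFŪ
  have hFUint : Integrable FU (volume.restrict S) := by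
    simp only [hFU]
    refine (hprod _ _ Mν (hDψcont e₀) (hDψcs e₀) hηνm fun p hp => hηνM p hp).add
      (integrable_finsetSum _ fun α _ => ?_)
    exact hprod _ _ Mν (hDψcont (e α)) (hDψcs (e α)) (hqνm α) fun p hp => hqνM α p hp
  have hηM_Ū : ∀ t ∈ Ioo 0 T, ∀ x, ‖η (Ubar t x)‖ ≤ Mall := fun t ht x =>
    (hMη _ (hŪD t (Ioo_subset_Ico_self ht) x)).trans (le_max_left _ _)
  have hqM_Ū : ∀ α, ∀ t ∈ Ioo 0 T, ∀ x, ‖q α (Ubar t x)‖ ≤ Mall := fun α t ht x =>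
    (hMq α _ (hŪD t (Ioo_subset_Ico_self ht) x)).trans (le_max_right _ _)
  have hFŪint : Integrable FŪ (volume.restrict S) := by
    simp only [hFŪ]
    refine (hprod _ _ Mall (hDψcont e₀) (hDψcs e₀) hη_mŪ fun p hp => hηM_Ū p.1 hp.1 p.2).add
      (integrable_finsetSum _ fun α _ => ?_)
    exact hprod _ _ Mall (hDψcont (e α)) (hDψcs (e α)) (hq_mŪ α) fun p hp => hqM_Ū α p.1 hp.1 p.2
  ----------------------------------------------------------------
  -- Step (V): assembly
  ----------------------------------------------------------------
  have hsum0 : (∫ p in S, Cterm p) + ∫ p in S, ψ p * g p = 0 := by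
    rw [← integral_add hCint hψgint, ← hcd0]
    exact (integral_congr_ae hident).symm
  -- the target integrand is `FU - FŪ - Cterm`
  have htarget : ∫ p in S, (fderiv ℝ ψ p e₀
          * (ην p - η (Ubar p.1 p.2) - fderiv ℝ η (Ubar p.1 p.2) (uν p - Ubar p.1 p.2))
        + ∑ α : Fin m, fderiv ℝ ψ p (e α)
          * (qν α p - q α (Ubar p.1 p.2)
            - fderiv ℝ η (Ubar p.1 p.2) (gν α p - G α (Ubar p.1 p.2))))
      = (∫ p in S, FU p) - (∫ p in S, FŪ p) - ∫ p in S, Cterm p := by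
    have hA : ∫ p in S, (FU p - FŪ p) = (∫ p in S, FU p) - ∫ p in S, FŪ p :=
      integral_sub hFUint hFŪint
    have hB : ∫ p in S, ((FU p - FŪ p) - Cterm p) = (∫ p in S, (FU p - FŪ p)) - ∫ p in S, Cterm p :=
      integral_sub (hFUint.sub hFŪint) hCint
    rw [← hA, ← hB]
    refine integral_congr_ae (ae_of_all _ fun p => ?_)
    simp only [hFU, hFŪ, hCterm, mul_sub, Finset.sum_sub_distrib]
    ring
  have hRHSint : Integrable (fun p : ℝ × EuclideanSpace ℝ (Fin m) => fderiv ℝ ψ p e₀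
          * (ην p - η (Ubar p.1 p.2) - fderiv ℝ η (Ubar p.1 p.2) (uν p - Ubar p.1 p.2))
        + ∑ α : Fin m, fderiv ℝ ψ p (e α)
          * (qν α p - q α (Ubar p.1 p.2)
            - fderiv ℝ η (Ubar p.1 p.2) (gν α p - G α (Ubar p.1 p.2))))
      (volume.restrict S) := by
    refine ((hFUint.sub hFŪint).sub hCint).congr (ae_of_all _ fun p => ?_)
    simp only [hFU, hFŪ, hCterm, Pi.sub_apply, mul_sub, Finset.sum_sub_distrib]
    ring
  refine ⟨hψgint, hRHSint, ?_⟩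
  rw [htarget]
  have hI' : 0 ≤ (∫ p in S, FU p) + ∫ x, ψ (0, x) * η (Ubar 0 x) := hI
  have hII' : (∫ p in S, FŪ p) + ∫ x, ψ (0, x) * η (Ubar 0 x) = 0 := hII
  linarith

/-! ## Vanishing of the relative entropy for abstract fields -/

set_option maxHeartbeats 3200000 in -- one long assembly proof (Dafermos (5.2.10)–(5.2.14))
/-- **Vanishing of the relative entropy for abstract fields (BDS (5.3.11)–(5.3.15) = Dafermos
(5.2.10)–(5.2.14)).** In the setting of `relEntropy_ineq_fields` (with `Ū` Lipschitz on every
box `[0,T'] × B̄(0,R)`, `T' < T`), assume moreover the structural bounds of BDS (5.3.4)–(5.3.5bis)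
on the slab: `h ≥ 0`, `∑_α |Y_α| ≤ s h` for some `s > 0`, and `‖Z_α‖ ≤ C_Z h`. Then `h = 0` a.e. on
`(0,T) × ℝᵐ`. Proof: (5.3.10) tested with `ψ = Θ(t)χ(t,x)` (`exists_timeProfile`,
`exists_coneCutoff`), the cone cutoff absorbing `∑_α ∂_αψ Y_α` by `∑|Y_α| ≤ s h`, the exponential
weight absorbing the Grönwall term `|ψ ∑_α D²η(Ū)[∂_αŪ, Z_α]| ≤ b ψ h`; verbatim the argument of
`dafermos_weak_strong_uniqueness_holds`. [cite: BrenierDeLellisSzekelyhidi2011, Thm 3] -/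
theorem relEntropy_vanish_fields
    {G : Fin m → EuclideanSpace ℝ (Fin n) → EuclideanSpace ℝ (Fin n)}
    {η : EuclideanSpace ℝ (Fin n) → ℝ} {q : Fin m → EuclideanSpace ℝ (Fin n) → ℝ}
    (hG : ∀ α, ContDiff ℝ 2 (G α)) (hη : ContDiff ℝ 2 η) (hq : ∀ α, ContDiff ℝ 2 (q α))
    (hcompat : ∀ V α, fderiv ℝ (q α) V = (fderiv ℝ η V).comp (fderiv ℝ (G α) V))
    {D : Set (EuclideanSpace ℝ (Fin n))} (hDc : IsCompact D) (hDconv : Convex ℝ D)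
    {T : ℝ} {Ubar : ℝ → EuclideanSpace ℝ (Fin m) → EuclideanSpace ℝ (Fin n)}
    (hŪw : IsWeakSolution Set.univ G T Ubar (Ubar 0)) (hŪD : ∀ t ∈ Ico 0 T, ∀ x, Ubar t x ∈ D)
    (hŪlip : ∀ T' < T, ∀ R : ℝ, ∃ K : ℝ≥0,
      LipschitzOnWith K (Function.uncurry Ubar) (Icc 0 T' ×ˢ closedBall 0 R))
    {uν : ℝ × EuclideanSpace ℝ (Fin m) → EuclideanSpace ℝ (Fin n)}
    {gν : Fin m → ℝ × EuclideanSpace ℝ (Fin m) → EuclideanSpace ℝ (Fin n)}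
    {ην : ℝ × EuclideanSpace ℝ (Fin m) → ℝ} {qν : Fin m → ℝ × EuclideanSpace ℝ (Fin m) → ℝ}
    (hum : AEStronglyMeasurable uν (volume.restrict (Ioo 0 T ×ˢ univ)))
    (hgm : ∀ α, AEStronglyMeasurable (gν α) (volume.restrict (Ioo 0 T ×ˢ univ)))
    (hηνm : AEStronglyMeasurable ην (volume.restrict (Ioo 0 T ×ˢ univ)))
    (hqνm : ∀ α, AEStronglyMeasurable (qν α) (volume.restrict (Ioo 0 T ×ˢ univ)))
    {Mν : ℝ} (huM : ∀ p ∈ Ioo 0 T ×ˢ (univ : Set (EuclideanSpace ℝ (Fin m))), ‖uν p‖ ≤ Mν)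
    (hgM : ∀ α, ∀ p ∈ Ioo 0 T ×ˢ (univ : Set (EuclideanSpace ℝ (Fin m))), ‖gν α p‖ ≤ Mν)
    (hηνM : ∀ p ∈ Ioo 0 T ×ˢ (univ : Set (EuclideanSpace ℝ (Fin m))), ‖ην p‖ ≤ Mν)
    (hqνM : ∀ α, ∀ p ∈ Ioo 0 T ×ˢ (univ : Set (EuclideanSpace ℝ (Fin m))), ‖qν α p‖ ≤ Mν)
    (hweak : ∀ (Φ : ℝ × EuclideanSpace ℝ (Fin m) → ℝ) (KΦ : ℝ≥0), LipschitzWith KΦ Φ →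
      HasCompactSupport Φ → ∀ T'' < T, (∀ t x, T'' ≤ t → Φ (t, x) = 0) →
      (∫ p in Ioo 0 T ×ˢ univ, (fderiv ℝ Φ p (1, 0) • uν p
          + ∑ α : Fin m, fderiv ℝ Φ p (0, EuclideanSpace.single α (1 : ℝ)) • gν α p))
        + ∫ x, Φ (0, x) • Ubar 0 x = 0)
    (hent : ∀ (Φ : ℝ × EuclideanSpace ℝ (Fin m) → ℝ) (KΦ : ℝ≥0), LipschitzWith KΦ Φ →
      HasCompactSupport Φ → (∀ p, 0 ≤ Φ p) → ∀ T'' < T, (∀ t x, T'' ≤ t → Φ (t, x) = 0) →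
      0 ≤ (∫ p in Ioo 0 T ×ˢ univ, (fderiv ℝ Φ p (1, 0) * ην p
          + ∑ α : Fin m, fderiv ℝ Φ p (0, EuclideanSpace.single α (1 : ℝ)) * qν α p))
        + ∫ x, Φ (0, x) * η (Ubar 0 x))
    {s : ℝ} (hspos : 0 < s)
    (hh_nn : ∀ p ∈ Ioo 0 T ×ˢ (univ : Set (EuclideanSpace ℝ (Fin m))),
      0 ≤ ην p - η (Ubar p.1 p.2) - fderiv ℝ η (Ubar p.1 p.2) (uν p - Ubar p.1 p.2))
    (hf_sum : ∀ p ∈ Ioo 0 T ×ˢ (univ : Set (EuclideanSpace ℝ (Fin m))),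
      ∑ α : Fin m, |qν α p - q α (Ubar p.1 p.2)
          - fderiv ℝ η (Ubar p.1 p.2) (gν α p - G α (Ubar p.1 p.2))|
        ≤ s * (ην p - η (Ubar p.1 p.2) - fderiv ℝ η (Ubar p.1 p.2) (uν p - Ubar p.1 p.2)))
    {CZ : ℝ} (hCZ : 0 ≤ CZ)
    (hZ_bd : ∀ p ∈ Ioo 0 T ×ˢ (univ : Set (EuclideanSpace ℝ (Fin m))), ∀ α : Fin m,
      ‖gν α p - G α (Ubar p.1 p.2) - fderiv ℝ (G α) (Ubar p.1 p.2) (uν p - Ubar p.1 p.2)‖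
        ≤ CZ * (ην p - η (Ubar p.1 p.2) - fderiv ℝ η (Ubar p.1 p.2) (uν p - Ubar p.1 p.2))) :
    ∀ᵐ p : ℝ × EuclideanSpace ℝ (Fin m), p.1 ∈ Set.Ioo 0 T →
      ην p - η (Ubar p.1 p.2) - fderiv ℝ η (Ubar p.1 p.2) (uν p - Ubar p.1 p.2) = 0 := by
  classical
  haveI : (volume : Measure (ℝ × EuclideanSpace ℝ (Fin m))).IsAddHaarMeasure :=
    Measure.prod.instIsAddHaarMeasure _ _
  -- `O = univ`
  have hO : IsOpen (univ : Set (EuclideanSpace ℝ (Fin n))) := isOpen_univ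
  have hD : D ⊆ univ := subset_univ D
  have hη2 : ContDiffOn ℝ 2 η univ := hη.contDiffOn
  have hη1 : ContDiffOn ℝ 1 η univ := hη2.of_le (by norm_num)
  obtain ⟨M2, hM2nn, hM2⟩ := exists_forall_norm_fderiv_fderiv_le hO hη2 hD hDc
  ----------------------------------------------------------------
  -- data of the classical solution and of the fields
  ----------------------------------------------------------------
  have hŪm : Measurable (Function.uncurry Ubar) := hŪw.1
  obtain ⟨CŪ, hŪC, -⟩ := hŪw.2.2.2.2.1
  obtain ⟨Mη, hMη⟩ : ∃ M : ℝ, ∀ V ∈ D, ‖η V‖ ≤ M :=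
    exists_norm_le_of_continuousOn hη.continuous.continuousOn hD hDc
  obtain ⟨M1, hM1nn, hM1⟩ := exists_forall_norm_fderiv_le hO hη1 hD hDc
  set S : Set (ℝ × EuclideanSpace ℝ (Fin m)) := Ioo 0 T ×ˢ univ with hSdef
  have hSm : MeasurableSet S := measurableSet_Ioo.prod MeasurableSet.univ
  have hSD_Ū : ∀ p ∈ S, Ubar p.1 p.2 ∈ D := fun p hp => hŪD p.1 (Ioo_subset_Ico_self hp.1) p.2
  have hSmem : ∀ᵐ p ∂(volume.restrict S), p ∈ S := ae_restrict_mem hSm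
  -- the relative entropy `h` of the fields is bounded and measurable on the slab
  set hrel : ℝ × EuclideanSpace ℝ (Fin m) → ℝ := fun p =>
    ην p - η (Ubar p.1 p.2) - fderiv ℝ η (Ubar p.1 p.2) (uν p - Ubar p.1 p.2)
    with hhrel
  have hu_Ū : AEStronglyMeasurable (fun p : ℝ × EuclideanSpace ℝ (Fin m) => Ubar p.1 p.2)
      (volume.restrict S) := hŪm.aestronglyMeasurable
  have hDη_m := aestronglyMeasurable_comp_slab (θ := fderiv ℝ η)
      (V := fun p : ℝ × EuclideanSpace ℝ (Fin m) => Ubar p.1 p.2) hO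
      (hη1.continuousOn_fderiv_of_isOpen hO le_rfl) hSm hŪm (fun p hp => hD (hSD_Ū p hp))
  have hη_mŪ : AEStronglyMeasurable (fun p : ℝ × EuclideanSpace ℝ (Fin m) => η (Ubar p.1 p.2))
      (volume.restrict S) :=
    aestronglyMeasurable_comp_slab (θ := η)
      (V := fun p : ℝ × EuclideanSpace ℝ (Fin m) => Ubar p.1 p.2) hO
      hη.continuous.continuousOn hSm hŪm (fun p hp => hD (hSD_Ū p hp))
  have hhrel_m : AEStronglyMeasurable hrel (volume.restrict S) := by
    have h1 := ContinuousLinearMap.aestronglyMeasurable_comp₂ (ContinuousLinearMap.id ℝ _) hDη_m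
      (hum.sub hu_Ū)
    simp only [ContinuousLinearMap.coe_id', id_eq, Pi.sub_apply] at h1
    exact (hηνm.sub hη_mŪ).sub h1
  set Mh : ℝ := Mν + Mη + M1 * (Mν + CŪ) with hMh
  have hhrel_bd : ∀ p ∈ S, ‖hrel p‖ ≤ Mh := by
    intro p hp
    refine (norm_sub_le _ _).trans (add_le_add ((norm_sub_le _ _).trans (add_le_add
      (hηνM p hp) (hMη _ (hSD_Ū p hp)))) ((le_opNorm _ _).trans (mul_le_mul
      (hM1 _ (hSD_Ū p hp)) ((norm_sub_le _ _).trans (add_le_add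
      (huM p hp) (hŪC p.1 (Ioo_subset_Ico_self hp.1) p.2)))
      (norm_nonneg _) hM1nn)))
  have hhrel_int : ∀ (cw : ℝ × EuclideanSpace ℝ (Fin m) → ℝ), Continuous cw → HasCompactSupport cw →
      Integrable (fun p => cw p * hrel p) (volume.restrict S) := by
    intro cw hcw hcws
    have := integrable_smul_of_norm_le (μ := volume.restrict S) hcw hcws hhrel_m (M := Mh)
      (by filter_upwards [hSmem] with p hp; exact hhrel_bd p hp)
    simpa only [smul_eq_mul] using this
  have hhrel_nn : ∀ p ∈ S, 0 ≤ hrel p := fun p hp => hh_nn p hp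
  ----------------------------------------------------------------
  -- the local statement: for a valid `(T', τ, ε, R₁)`, `h = 0` a.e. on the region
  ----------------------------------------------------------------
  have hlocal : ∀ (T' τ ε R₁ : ℝ), 0 < ε → 0 < τ - ε → τ + ε < T' → T' < T →
      ∀ᵐ p ∂volume, p ∈ S → p.1 ∈ Ioo (τ - ε) (τ + ε) →
        Real.sqrt (1 + ‖p.2‖ ^ 2) + s * p.1 < R₁ → hrel p = 0 := by
    intro T' τ ε R₁ hε hτε hτT' hT'T
    have hT'0 : 0 < T' := by linarith
    -- the box and the constants depending on `Ū` there
    set R : ℝ := |R₁| + 2 + s with hRdef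
    obtain ⟨K, hK⟩ := hŪlip T' hT'T R
    have hKnn : (0 : ℝ) ≤ K := K.2
    set b : ℝ := (m : ℝ) * M2 * K * CZ with hbdef
    have hbnn : 0 ≤ b := by positivity
    -- the cutoffs
    obtain ⟨Θ, β, hΘC, hΘlow, hΘnn, hΘT, hβc, hβnn, hβpos, hβout, hΘd⟩ :=
      exists_timeProfile b τ ε hε
    obtain ⟨χ, hχC, hχnn, hχone, hχsupp, hχtr⟩ := exists_coneCutoff (m := m) s R₁
    set ψ : ℝ × EuclideanSpace ℝ (Fin m) → ℝ := fun p => Θ p.1 * χ p with hψdef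
    have hΘ1C : ContDiff ℝ 1 fun p : ℝ × EuclideanSpace ℝ (Fin m) => Θ p.1 := hΘC.comp contDiff_fst
    have hψC : ContDiff ℝ 1 ψ := hΘ1C.mul hχC
    have hψnn : ∀ p, 0 ≤ ψ p := fun p => mul_nonneg (hΘnn _) (hχnn _)
    have hxr : ∀ x : EuclideanSpace ℝ (Fin m), ‖x‖ ≤ Real.sqrt (1 + ‖x‖ ^ 2) := fun x => by
      rw [Real.le_sqrt (norm_nonneg _) (by positivity)]; linarith
    -- support of `ψ`
    have hsupp_sub : Function.support ψ
        ⊆ Icc (-1) (τ + ε) ×ˢ closedBall (0 : EuclideanSpace ℝ (Fin m)) (|R₁| + 1 + s) := by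
      intro p hp
      rw [Function.mem_support] at hp
      have hΘp : Θ p.1 ≠ 0 := left_ne_zero_of_mul hp
      have hχp : χ p ≠ 0 := right_ne_zero_of_mul hp
      have ht1 : -1 ≤ p.1 := by
        by_contra h
        exact hΘp (hΘlow _ (le_of_not_ge h))
      have ht2 : p.1 ≤ τ + ε := by
        by_contra h
        exact hΘp (hΘT _ (le_of_not_ge h))
      have hy := hχsupp p hχp
      refine ⟨⟨ht1, ht2⟩, ?_⟩
      rw [mem_closedBall, dist_zero_right]
      have : -s ≤ s * p.1 := by nlinarith
      linarith [le_abs_self R₁, hxr p.2]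
    have hKc : IsCompact (Icc (-1) (τ + ε) ×ˢ closedBall (0 : EuclideanSpace ℝ (Fin m))
        (|R₁| + 1 + s)) := isCompact_Icc.prod (isCompact_closedBall _ _)
    have hψc : HasCompactSupport ψ := HasCompactSupport.of_support_subset_isCompact hKc hsupp_sub
    have hψs : tsupport ψ ⊆ Iio T' ×ˢ ball (0 : EuclideanSpace ℝ (Fin m)) R := by
      refine (closure_minimal hsupp_sub hKc.isClosed).trans ?_
      rintro ⟨t, x⟩ ⟨ht, hx⟩
      refine ⟨lt_of_le_of_lt ht.2 hτT', ?_⟩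
      rw [mem_closedBall, dist_zero_right] at hx
      rw [mem_ball, dist_zero_right]
      simp only [hRdef]
      linarith [le_abs_self R₁, abs_nonneg R₁, neg_abs_le R₁]
    ----------------------------------------------------------------
    -- (5.3.10) for `ψ`
    ----------------------------------------------------------------
    obtain ⟨hgint, hRint, hineq⟩ := relEntropy_ineq_fields hG hη hq hcompat hDc hDconv hŪw hŪD
      hT'0 hT'T hK hum hgm hηνm hqνm huM hgM hηνM hqνM hweak hent hψC hψc hψnn hψs
    set e₀ : ℝ × EuclideanSpace ℝ (Fin m) := (1, 0) with he₀
    set e : Fin m → ℝ × EuclideanSpace ℝ (Fin m) :=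
      fun α => (0, EuclideanSpace.single α (1 : ℝ)) with he
    have hen : ∀ α, ‖e α‖ = 1 := fun α => norm_spaceDir α
    set gp : ℝ × EuclideanSpace ℝ (Fin m) → ℝ := fun p => ∑ α : Fin m,
      fderiv ℝ (fderiv ℝ η) (Ubar p.1 p.2) (fderiv ℝ (Function.uncurry Ubar) p (e α))
        (gν α p - G α (Ubar p.1 p.2)
          - fderiv ℝ (G α) (Ubar p.1 p.2) (uν p - Ubar p.1 p.2)) with hgp
    set fα : Fin m → ℝ × EuclideanSpace ℝ (Fin m) → ℝ := fun α p =>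
      qν α p - q α (Ubar p.1 p.2)
        - fderiv ℝ η (Ubar p.1 p.2) (gν α p - G α (Ubar p.1 p.2)) with hfα
    set Fp : ℝ × EuclideanSpace ℝ (Fin m) → ℝ := fun p =>
      fderiv ℝ ψ p e₀ * hrel p + ∑ α : Fin m, fderiv ℝ ψ p (e α) * fα α p with hFp
    have hgint' : Integrable (fun p => ψ p * gp p) (volume.restrict S) := hgint
    have hRint' : Integrable Fp (volume.restrict S) := hRint
    have hineq' : ∫ p in S, ψ p * gp p ≤ ∫ p in S, Fp p := hineq
    -- boxes
    set Bc : Set (ℝ × EuclideanSpace ℝ (Fin m)) := Icc 0 T' ×ˢ closedBall 0 R with hBc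
    have hsupp_S : ∀ p ∈ tsupport ψ, p ∈ S → Bc ∈ 𝓝 p := by
      intro p hp hpS
      have hpo : p ∈ Ioo 0 T' ×ˢ ball (0 : EuclideanSpace ℝ (Fin m)) R :=
        ⟨⟨hpS.1.1, (hψs hp).1⟩, (hψs hp).2⟩
      exact Filter.mem_of_superset ((isOpen_Ioo.prod isOpen_ball).mem_nhds hpo)
        (Set.prod_mono Ioo_subset_Icc_self ball_subset_closedBall)
    have hdŪb : ∀ p ∈ tsupport ψ, p ∈ S → ∀ α, ‖fderiv ℝ (Function.uncurry Ubar) p (e α)‖ ≤ K := by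
      intro p hp hpS α
      refine (le_opNorm _ _).trans ?_
      rw [hen, mul_one]
      exact norm_fderiv_le_of_lipschitzOn ℝ (hsupp_S p hp hpS) hK
    ----------------------------------------------------------------
    -- Step 1: `∫ ψ g ≥ -b ∫ ψ h`
    ----------------------------------------------------------------
    have hg_bd : ∀ p ∈ tsupport ψ, p ∈ S → |gp p| ≤ b * hrel p := by
      intro p hp hpS
      simp only [hgp]
      refine (Finset.abs_sum_le_sum_abs _ _).trans ?_
      have h1 : ∀ α, |fderiv ℝ (fderiv ℝ η) (Ubar p.1 p.2) (fderiv ℝ (Function.uncurry Ubar) p (e α))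
          (gν α p - G α (Ubar p.1 p.2)
            - fderiv ℝ (G α) (Ubar p.1 p.2) (uν p - Ubar p.1 p.2))|
          ≤ M2 * K * (CZ * hrel p) := by
        intro α
        rw [← Real.norm_eq_abs]
        refine (le_opNorm _ _).trans (mul_le_mul ((le_opNorm _ _).trans (mul_le_mul
          (hM2 _ (hSD_Ū p hpS)) (hdŪb p hp hpS α) (norm_nonneg _) hM2nn))
          (hZ_bd p hpS α) (norm_nonneg _) (mul_nonneg hM2nn hKnn)) |>.trans ?_
        exact le_of_eq (by ring)
      calc ∑ α, |fderiv ℝ (fderiv ℝ η) (Ubar p.1 p.2) (fderiv ℝ (Function.uncurry Ubar) p (e α))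
            (gν α p - G α (Ubar p.1 p.2)
              - fderiv ℝ (G α) (Ubar p.1 p.2) (uν p - Ubar p.1 p.2))|
          ≤ ∑ _α : Fin m, M2 * K * (CZ * hrel p) := Finset.sum_le_sum fun α _ => h1 α
        _ = b * hrel p := by
          rw [Finset.sum_const, Finset.card_univ, Fintype.card_fin, nsmul_eq_mul, hbdef]; ring
    have hlow_pt : ∀ p ∈ S, -b * (ψ p * hrel p) ≤ ψ p * gp p := by
      intro p hp
      by_cases hps : p ∈ tsupport ψ
      · have h1 := hg_bd p hps hp
        have h2 := hψnn p
        have h3 : -(b * hrel p) ≤ gp p := by linarith [neg_abs_le (gp p)]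
        nlinarith
      · simp [image_eq_zero_of_notMem_tsupport hps]
    have hψh_int : Integrable (fun p => ψ p * hrel p) (volume.restrict S) :=
      hhrel_int ψ hψC.continuous hψc
    have hstep1 : -b * ∫ p in S, ψ p * hrel p ≤ ∫ p in S, ψ p * gp p := by
      rw [← integral_const_mul]
      refine integral_mono_ae (hψh_int.const_mul _) hgint' ?_
      filter_upwards [hSmem] with p hp
      exact hlow_pt p hp
    ----------------------------------------------------------------
    -- Step 2: `∫ F ≤ -b ∫ ψ h - ∫ w h`
    ----------------------------------------------------------------
    set w : ℝ × EuclideanSpace ℝ (Fin m) → ℝ := fun p => Real.exp (-b * p.1) * β p.1 * χ p with hw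
    have hwc : Continuous w :=
      ((Real.continuous_exp.comp (continuous_const.mul continuous_fst)).mul
        (hβc.comp continuous_fst)).mul hχC.continuous
    have hw_supp : Function.support w
        ⊆ Icc (τ - ε) (τ + ε) ×ˢ closedBall (0 : EuclideanSpace ℝ (Fin m)) (|R₁| + 1 + s * (|τ| + ε)) := by
      intro p hp
      rw [Function.mem_support] at hp
      have hβp : β p.1 ≠ 0 := by
        intro h; apply hp; simp only [hw, h, mul_zero, zero_mul]
      have hχp : χ p ≠ 0 := right_ne_zero_of_mul hp
      have ht : p.1 ∈ Ioo (τ - ε) (τ + ε) := by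
        by_contra h; exact hβp (hβout _ h)
      refine ⟨Ioo_subset_Icc_self ht, ?_⟩
      rw [mem_closedBall, dist_zero_right]
      have hy := hχsupp p hχp
      have h1 : -(s * (|τ| + ε)) ≤ s * p.1 := by
        have : -(|τ| + ε) ≤ p.1 := by linarith [ht.1, neg_abs_le τ]
        nlinarith
      linarith [le_abs_self R₁, hxr p.2]
    have hwcs : HasCompactSupport w := HasCompactSupport.of_support_subset_isCompact
      (isCompact_Icc.prod (isCompact_closedBall _ _)) hw_supp
    have hwh_int : Integrable (fun p => w p * hrel p) (volume.restrict S) := hhrel_int w hwc hwcs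
    -- derivative of `ψ`
    have hΘ'ev : ∀ p : ℝ × EuclideanSpace ℝ (Fin m), 0 ≤ p.1 → ∀ v : ℝ × EuclideanSpace ℝ (Fin m),
        fderiv ℝ ψ p v = Θ p.1 * fderiv ℝ χ p v
          + χ p * ((-b * Θ p.1 - Real.exp (-b * p.1) * β p.1) * v.1) := fun p hp v =>
      fderiv_timeProfile_mul (hΘd p.1 hp) (hχC.differentiable one_ne_zero p) v
    have hup_pt : ∀ p ∈ S, Fp p ≤ -b * (ψ p * hrel p) - w p * hrel p := by
      intro p hp
      have ht0 : 0 ≤ p.1 := hp.1.1.le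
      have hh0 : 0 ≤ hrel p := hhrel_nn p hp
      have htr := hχtr p (hrel p) (fun α => fα α p) hh0 (hf_sum p hp)
      simp only [hFp, hΘ'ev p ht0]
      have h1 : ∀ α, (Θ p.1 * fderiv ℝ χ p (e α)
          + χ p * ((-b * Θ p.1 - Real.exp (-b * p.1) * β p.1) * (e α).1)) * fα α p
          = Θ p.1 * (fderiv ℝ χ p (e α) * fα α p) := by
        intro α; simp only [he]; ring
      simp_rw [h1]
      rw [← Finset.mul_sum]
      have h2 : Θ p.1 * (fderiv ℝ χ p e₀ * hrel p) + Θ p.1 * ∑ α, fderiv ℝ χ p (e α) * fα α p ≤ 0 := by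
        rw [← mul_add]
        exact mul_nonpos_of_nonneg_of_nonpos (hΘnn _) htr
      have h3 : (Θ p.1 * fderiv ℝ χ p e₀ + χ p * ((-b * Θ p.1 - Real.exp (-b * p.1) * β p.1) * e₀.1))
          * hrel p + Θ p.1 * ∑ α, fderiv ℝ χ p (e α) * fα α p
          = (Θ p.1 * (fderiv ℝ χ p e₀ * hrel p) + Θ p.1 * ∑ α, fderiv ℝ χ p (e α) * fα α p)
            + (-b * (ψ p * hrel p) - w p * hrel p) := by
        simp only [he₀, hψdef, hw]; ring
      rw [h3]
      linarith
    have hstep2 : ∫ p in S, Fp p ≤ -b * (∫ p in S, ψ p * hrel p) - ∫ p in S, w p * hrel p := by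
      rw [← integral_const_mul, ← integral_sub (hψh_int.const_mul _) hwh_int]
      refine integral_mono_ae hRint' ((hψh_int.const_mul _).sub hwh_int) ?_
      filter_upwards [hSmem] with p hp
      exact hup_pt p hp
    ----------------------------------------------------------------
    -- Step 3: `∫ w h ≤ 0`, hence `w h = 0` a.e. on the slab
    ----------------------------------------------------------------
    have hwh0 : ∫ p in S, w p * hrel p = 0 := by
      have h1 : ∫ p in S, w p * hrel p ≤ 0 := by linarith
      have h2 : 0 ≤ ∫ p in S, w p * hrel p := by
        refine setIntegral_nonneg hSm fun p hp => mul_nonneg ?_ (hhrel_nn p hp)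
        exact mul_nonneg (mul_nonneg (Real.exp_pos _).le (hβnn _)) (hχnn _)
      linarith
    have hwh_ae : ∀ᵐ p ∂(volume.restrict S), w p * hrel p = 0 := by
      have hnn : 0 ≤ᵐ[volume.restrict S] fun p => w p * hrel p := by
        filter_upwards [hSmem] with p hp
        exact mul_nonneg (mul_nonneg (mul_nonneg (Real.exp_pos _).le (hβnn _)) (hχnn _))
          (hhrel_nn p hp)
      exact (integral_eq_zero_iff_of_nonneg_ae hnn hwh_int).1 hwh0
    ----------------------------------------------------------------
    -- Step 4: conclusion on the region `{β > 0, χ = 1}`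
    ----------------------------------------------------------------
    have hfin : ∀ᵐ p ∂(volume.restrict S), p.1 ∈ Ioo (τ - ε) (τ + ε) →
        Real.sqrt (1 + ‖p.2‖ ^ 2) + s * p.1 < R₁ → hrel p = 0 := by
      filter_upwards [hwh_ae, hSmem] with p hp _ ht hR₁
      have hwpos : 0 < w p := by
        simp only [hw, hχone p hR₁, mul_one]
        exact mul_pos (Real.exp_pos _) (hβpos _ ht)
      rcases mul_eq_zero.1 hp with h | h
      · exact absurd h hwpos.ne'
      · exact h
    exact (ae_restrict_iff' hSm).1 hfin
  ----------------------------------------------------------------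
  -- Step 5: a countable family of regions exhausts the slab
  ----------------------------------------------------------------
  have hall : ∀ i : ℚ × ℚ × ℚ × ℕ, ∀ᵐ p ∂(volume : Measure (ℝ × EuclideanSpace ℝ (Fin m))),
      (0 < (i.2.2.1 : ℝ) ∧ 0 < (i.2.1 : ℝ) - i.2.2.1 ∧ (i.2.1 : ℝ) + i.2.2.1 < i.1 ∧ (i.1 : ℝ) < T) →
      p ∈ S → p.1 ∈ Ioo ((i.2.1 : ℝ) - i.2.2.1) (i.2.1 + i.2.2.1) →
      Real.sqrt (1 + ‖p.2‖ ^ 2) + s * p.1 < (i.2.2.2 : ℝ) → hrel p = 0 := by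
    rintro ⟨T', τ, ε, R₁⟩
    by_cases hv : (0 < (ε : ℝ) ∧ 0 < (τ : ℝ) - ε ∧ (τ : ℝ) + ε < T' ∧ (T' : ℝ) < T)
    · filter_upwards [hlocal T' τ ε R₁ hv.1 hv.2.1 hv.2.2.1 hv.2.2.2] with p hp _
      exact hp
    · exact ae_of_all _ fun p h => absurd h hv
  have hae := ae_all_iff.2 hall
  filter_upwards [hae] with p hp ht
  obtain ⟨T', htT', hT'T⟩ := exists_rat_btwn ht.2
  have hδ : 0 < min p.1 ((T' : ℝ) - p.1) := lt_min ht.1 (by linarith)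
  obtain ⟨ε, hε0, hεδ⟩ := exists_rat_btwn (show (0 : ℝ) < min p.1 ((T' : ℝ) - p.1) / 2 by positivity)
  obtain ⟨τ, hτ1, hτ2⟩ := exists_rat_btwn (show p.1 < p.1 + ε by linarith)
  obtain ⟨R₁, hR₁⟩ := exists_nat_gt (Real.sqrt (1 + ‖p.2‖ ^ 2) + s * p.1)
  have hmin1 := min_le_left p.1 ((T' : ℝ) - p.1)
  have hmin2 := min_le_right p.1 ((T' : ℝ) - p.1)
  exact hp ⟨T', τ, ε, R₁⟩ ⟨hε0, by linarith, by linarith, hT'T⟩ ⟨ht, mem_univ _⟩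
    ⟨by linarith, by linarith⟩ hR₁

/-! ## The discharge -/

/-- **Weak–strong uniqueness for measure-valued solutions (Brenier–De Lellis–Székelyhidi 2011,
Theorem 3; discharge of `brenierDeLellisSzekelyhidi_mv_weak_strong_uniqueness`).** A bounded
admissible measure-valued solution `ν` of `∂ₜ⟨ν,ξ⟩ + ∑_α ∂_α⟨ν,G_α⟩ = 0` with the single convex
entropy inequality for `(η,q)`, `D²η ≥ c₀ Id`, and the initial datum `U(0,·)` of a bounded
Lipschitz solution `U` on `[0,T]` is the Dirac mass `δ_{U(t,x)}` for a.e. `(t,x) ∈ (0,T) × ℝᵐ`.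
Proof (BDS pp. 8–9): the pairings `⟨ν,ξ⟩, ⟨ν,G_α⟩, ⟨ν,η⟩, ⟨ν,q_α⟩` are bounded measurable fields
satisfying the Lipschitz-tested weak identity and entropy inequality
(`weakIdentity_lipschitz_of_fields`, `entropyIneq_lipschitz_of_fields`); with
`𝒟 = B̄(0, max(K, C))` carrying every `ν_{t,x}` and the values of `U`, the bounds (5.3.4)–(5.3.5bis)
`h ≥ (c₀/2) ∫|ξ - U|² dν`, `|Y_α| ≤ C ∫|ξ - U|² dν`, `‖Z_α‖ ≤ C ∫|ξ - U|² dν` follow by integrating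
`relEntropy_lower`, `fluxDefect_le`, `taylorDefect_le` against `ν_{t,x}`; `relEntropy_vanish_fields`
gives `h = 0` a.e., whence `∫ |ξ - U(t,x)|² dν_{t,x} = 0` and `ν_{t,x} = δ_{U(t,x)}`.
[cite: BrenierDeLellisSzekelyhidi2011, Thm 3] -/
theorem brenierDeLellisSzekelyhidi_mv_weak_strong_uniqueness_holds :
    brenierDeLellisSzekelyhidi_mv_weak_strong_uniqueness := by
  classical
  intro m n G η q hG hη hq hcompat hconv T hT U hUlip hUw ν hν
  obtain ⟨c, hcpos, hc⟩ := hconv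
  obtain ⟨hprob, ⟨K, hνK, hU0K⟩, -, hmeas, -, -, -, -, hweakν, hentν⟩ := hν
  obtain ⟨Klip, hKlip⟩ := hUlip
  obtain ⟨C, hUC, -⟩ := hUw.2.2.2.2.1
  have hO : IsOpen (univ : Set (EuclideanSpace ℝ (Fin n))) := isOpen_univ
  ----------------------------------------------------------------
  -- the convex compact set `D` carrying every `ν_{t,x}` and the values of `U`
  ----------------------------------------------------------------
  set R₀ : ℝ := max K C with hR₀
  set D : Set (EuclideanSpace ℝ (Fin n)) := closedBall 0 R₀ with hDdef
  have hD : D ⊆ univ := subset_univ D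
  have hDc : IsCompact D := isCompact_closedBall _ _
  have hDconv : Convex ℝ D := convex_closedBall _ _
  have hŪD : ∀ t ∈ Ico 0 T, ∀ x, U t x ∈ D := fun t ht x =>
    mem_closedBall_zero_iff.2 ((hUC t ht x).trans (le_max_right _ _))
  have hνD : ∀ t x, ∀ᵐ ξ ∂(ν t x), ξ ∈ D := fun t x => by
    filter_upwards [mem_ae_iff.2 (hνK t x)] with ξ hξ
    exact closedBall_subset_closedBall (le_max_left _ _) hξ
  have hŪlip : ∀ T' < T, ∀ R : ℝ, ∃ K' : ℝ≥0,
      LipschitzOnWith K' (Function.uncurry U) (Icc 0 T' ×ˢ closedBall 0 R) := fun T' hT' R =>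
    ⟨Klip, hKlip.mono (Set.prod_mono (Icc_subset_Icc le_rfl hT'.le) (subset_univ _))⟩
  -- smoothness levels
  have hG2 : ∀ α, ContDiffOn ℝ 2 (G α) univ := fun α => (hG α).contDiffOn
  have hG1 : ∀ α, ContDiffOn ℝ 1 (G α) univ := fun α => (hG2 α).of_le (by norm_num)
  have hη2 : ContDiffOn ℝ 2 η univ := hη.contDiffOn
  have hη1 : ContDiffOn ℝ 1 η univ := hη2.of_le (by norm_num)
  have hq1 : ∀ α, ContDiffOn ℝ 1 (q α) univ := fun α => (hq α).contDiffOn.of_le (by norm_num)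
  ----------------------------------------------------------------
  -- integrability against the fibres `ν_{t,x}` and the four fields
  ----------------------------------------------------------------
  have hi_id : ∀ t x, Integrable (fun ξ : EuclideanSpace ℝ (Fin n) => ξ) (ν t x) := fun t x =>
    integrable_of_continuous_of_ae_mem hDc (hνD t x) continuous_id
  have hi_G : ∀ α t x, Integrable (G α) (ν t x) := fun α t x =>
    integrable_of_continuous_of_ae_mem hDc (hνD t x) (hG α).continuous
  have hi_η : ∀ t x, Integrable η (ν t x) := fun t x =>
    integrable_of_continuous_of_ae_mem hDc (hνD t x) hη.continuous
  have hi_q : ∀ α t x, Integrable (q α) (ν t x) := fun α t x =>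
    integrable_of_continuous_of_ae_mem hDc (hνD t x) (hq α).continuous
  have hi_sq : ∀ p : ℝ × EuclideanSpace ℝ (Fin m),
      Integrable (fun ξ => ‖ξ - U p.1 p.2‖ ^ 2) (ν p.1 p.2) := fun p =>
    integrable_of_continuous_of_ae_mem hDc (hνD p.1 p.2)
      ((continuous_id.sub continuous_const).norm.pow 2)
  set uν : ℝ × EuclideanSpace ℝ (Fin m) → EuclideanSpace ℝ (Fin n) := fun p => ∫ ξ, ξ ∂ν p.1 p.2
    with huν
  set gν : Fin m → ℝ × EuclideanSpace ℝ (Fin m) → EuclideanSpace ℝ (Fin n) := fun α p =>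
    ∫ ξ, G α ξ ∂ν p.1 p.2 with hgν
  set ην : ℝ × EuclideanSpace ℝ (Fin m) → ℝ := fun p => ∫ ξ, η ξ ∂ν p.1 p.2 with hην
  set qν : Fin m → ℝ × EuclideanSpace ℝ (Fin m) → ℝ := fun α p => ∫ ξ, q α ξ ∂ν p.1 p.2 with hqν
  have hum : Measurable uν := measurable_integral_fibre hmeas continuous_id hi_id
  have hgm : ∀ α, Measurable (gν α) := fun α =>
    measurable_integral_fibre hmeas (hG α).continuous (hi_G α)
  have hηνm : Measurable ην := hmeas η hη.continuous
  have hqνm : ∀ α, Measurable (qν α) := fun α => hmeas (q α) (hq α).continuous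
  -- bounds
  obtain ⟨MG, hMG⟩ : ∃ M : ℝ, ∀ α, ∀ V ∈ D, ‖G α V‖ ≤ M := by
    have h1 : ∀ α, ∃ M : ℝ, ∀ V ∈ D, ‖G α V‖ ≤ M := fun α =>
      exists_norm_le_of_continuousOn (hG α).continuous.continuousOn hD hDc
    choose Mα hMα using h1
    refine ⟨∑ α, |Mα α|, fun α V hV => (hMα α V hV).trans ((le_abs_self _).trans ?_)⟩
    exact Finset.single_le_sum (f := fun α => |Mα α|) (fun α _ => abs_nonneg _) (Finset.mem_univ α)
  obtain ⟨Mη, hMη⟩ : ∃ M : ℝ, ∀ V ∈ D, ‖η V‖ ≤ M :=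
    exists_norm_le_of_continuousOn hη.continuous.continuousOn hD hDc
  obtain ⟨Mq, hMq⟩ : ∃ M : ℝ, ∀ α, ∀ V ∈ D, ‖q α V‖ ≤ M := by
    have h1 : ∀ α, ∃ M : ℝ, ∀ V ∈ D, ‖q α V‖ ≤ M := fun α =>
      exists_norm_le_of_continuousOn (hq α).continuous.continuousOn hD hDc
    choose Mα hMα using h1
    refine ⟨∑ α, |Mα α|, fun α V hV => (hMα α V hV).trans ((le_abs_self _).trans ?_)⟩
    exact Finset.single_le_sum (f := fun α => |Mα α|) (fun α _ => abs_nonneg _) (Finset.mem_univ α)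
  have huνb : ∀ p, ‖uν p‖ ≤ R₀ := fun p =>
    norm_integral_le_of_ae_mem (hνD p.1 p.2) fun ξ hξ => mem_closedBall_zero_iff.1 hξ
  have hgνb : ∀ α p, ‖gν α p‖ ≤ MG := fun α p => norm_integral_le_of_ae_mem (hνD p.1 p.2) (hMG α)
  have hηνb : ∀ p, ‖ην p‖ ≤ Mη := fun p => norm_integral_le_of_ae_mem (hνD p.1 p.2) hMη
  have hqνb : ∀ α p, ‖qν α p‖ ≤ Mq := fun α p => norm_integral_le_of_ae_mem (hνD p.1 p.2) (hMq α)
  set Mν : ℝ := max (max R₀ MG) (max Mη Mq) with hMν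
  have huM : ∀ p ∈ Ioo 0 T ×ˢ (univ : Set (EuclideanSpace ℝ (Fin m))), ‖uν p‖ ≤ Mν :=
    fun p _ => (huνb p).trans ((le_max_left _ _).trans (le_max_left _ _))
  have hgM : ∀ α, ∀ p ∈ Ioo 0 T ×ˢ (univ : Set (EuclideanSpace ℝ (Fin m))), ‖gν α p‖ ≤ Mν :=
    fun α p _ => (hgνb α p).trans ((le_max_right _ _).trans (le_max_left _ _))
  have hηνM : ∀ p ∈ Ioo 0 T ×ˢ (univ : Set (EuclideanSpace ℝ (Fin m))), ‖ην p‖ ≤ Mν :=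
    fun p _ => (hηνb p).trans ((le_max_left _ _).trans (le_max_right _ _))
  have hqνM : ∀ α, ∀ p ∈ Ioo 0 T ×ˢ (univ : Set (EuclideanSpace ℝ (Fin m))), ‖qν α p‖ ≤ Mν :=
    fun α p _ => (hqνb α p).trans ((le_max_right _ _).trans (le_max_right _ _))
  have hU0M : ∀ x, ‖U 0 x‖ ≤ Mν := fun x =>
    (hU0K x).trans ((le_max_left K C).trans ((le_max_left _ _).trans (le_max_left _ _)))
  have hηU0M : ∀ x, ‖η (U 0 x)‖ ≤ Mν := fun x =>
    (hMη _ (hŪD 0 ⟨le_rfl, hT⟩ x)).trans ((le_max_left _ _).trans (le_max_right _ _))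
  ----------------------------------------------------------------
  -- (i), (ii): the weak identity and the entropy inequality against Lipschitz test functions
  ----------------------------------------------------------------
  have hweak : ∀ (Φ : ℝ × EuclideanSpace ℝ (Fin m) → ℝ) (KΦ : ℝ≥0), LipschitzWith KΦ Φ →
      HasCompactSupport Φ → ∀ T'' < T, (∀ t x, T'' ≤ t → Φ (t, x) = 0) →
      (∫ p in Ioo 0 T ×ˢ univ, (fderiv ℝ Φ p (1, 0) • uν p
          + ∑ α : Fin m, fderiv ℝ Φ p (0, EuclideanSpace.single α (1 : ℝ)) • gν α p))
        + ∫ x, Φ (0, x) • U 0 x = 0 := by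
    intro Φ KΦ hΦ hΦc T'' hT'' hΦT
    exact weakIdentity_lipschitz_of_fields (M := Mν) hum.aestronglyMeasurable
      (fun α => (hgm α).aestronglyMeasurable) hUw.2.1.aestronglyMeasurable
      (ae_of_all _ fun p => (huνb p).trans ((le_max_left _ _).trans (le_max_left _ _)))
      (fun α => ae_of_all _ fun p => (hgνb α p).trans ((le_max_right _ _).trans (le_max_left _ _)))
      hU0M (fun φ hφ => hweakν φ hφ) hΦ hΦc hT'' hΦT
  have hent : ∀ (Φ : ℝ × EuclideanSpace ℝ (Fin m) → ℝ) (KΦ : ℝ≥0), LipschitzWith KΦ Φ →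
      HasCompactSupport Φ → (∀ p, 0 ≤ Φ p) → ∀ T'' < T, (∀ t x, T'' ≤ t → Φ (t, x) = 0) →
      0 ≤ (∫ p in Ioo 0 T ×ˢ univ, (fderiv ℝ Φ p (1, 0) * ην p
          + ∑ α : Fin m, fderiv ℝ Φ p (0, EuclideanSpace.single α (1 : ℝ)) * qν α p))
        + ∫ x, Φ (0, x) * η (U 0 x) := by
    intro Φ KΦ hΦ hΦc hΦnn T'' hT'' hΦT
    have hη0m : AEStronglyMeasurable (fun x => η (U 0 x)) volume :=
      (hη.continuous.measurable.comp hUw.2.1).aestronglyMeasurable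
    exact entropyIneq_lipschitz_of_fields (M := Mν) hηνm.aestronglyMeasurable
      (fun α => (hqνm α).aestronglyMeasurable) hη0m
      (ae_of_all _ fun p => (hηνb p).trans ((le_max_left _ _).trans (le_max_right _ _)))
      (fun α => ae_of_all _ fun p => (hqνb α p).trans ((le_max_right _ _).trans (le_max_right _ _)))
      hηU0M (fun ψ hψ hψnn => hentν ψ hψ hψnn) hΦ hΦc hΦnn hT'' hΦT
  ----------------------------------------------------------------
  -- (iv): the structural bounds, integrating the pointwise quadratic bounds against `ν_{t,x}`
  ----------------------------------------------------------------
  have hc' : ∀ V ∈ D, ∀ ξ : EuclideanSpace ℝ (Fin n),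
      c * ‖ξ‖ ^ 2 ≤ fderiv ℝ (fderiv ℝ η) V ξ ξ := by
    intro V _ ξ
    have := hc V ξ
    rw [iteratedFDeriv_two_apply] at this
    simpa using this
  have hlow : ∀ V ∈ D, ∀ W ∈ D, c / 2 * ‖V - W‖ ^ 2 ≤ η V - η W - fderiv ℝ η W (V - W) :=
    fun V hV W hW => relEntropy_lower hO hη2 hD hDconv hc' hV hW
  obtain ⟨LDη, hLDη⟩ := exists_lipschitzOnWith_fderiv hO hη2 hD hDc hDconv
  obtain ⟨MDG, hMDGnn, hMDG⟩ : ∃ M : ℝ, 0 ≤ M ∧ ∀ α, ∀ V ∈ D, ‖fderiv ℝ (G α) V‖ ≤ M := by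
    have h1 : ∀ α, ∃ M : ℝ, ∀ V ∈ D, ‖fderiv ℝ (G α) V‖ ≤ M := fun α => by
      obtain ⟨M, -, hM⟩ := exists_forall_norm_fderiv_le hO (hG1 α) hD hDc
      exact ⟨M, hM⟩
    choose Mα hMα using h1
    refine ⟨∑ α, |Mα α|, Finset.sum_nonneg fun α _ => abs_nonneg _, fun α V hV =>
      (hMα α V hV).trans ((le_abs_self _).trans ?_)⟩
    exact Finset.single_le_sum (f := fun α => |Mα α|) (fun α _ => abs_nonneg _) (Finset.mem_univ α)
  obtain ⟨LDG, hLDG⟩ : ∃ L : ℝ≥0, ∀ α, LipschitzOnWith L (fderiv ℝ (G α)) D := by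
    have h1 : ∀ α, ∃ L : ℝ≥0, LipschitzOnWith L (fderiv ℝ (G α)) D := fun α =>
      exists_lipschitzOnWith_fderiv hO (hG2 α) hD hDc hDconv
    choose Lα hLα using h1
    exact ⟨∑ α, Lα α, fun α => (hLα α).weaken
      (Finset.single_le_sum (f := Lα) (fun _ _ => bot_le) (Finset.mem_univ α))⟩
  set Cf : ℝ := LDη * MDG with hCf
  have hCfnn : 0 ≤ Cf := mul_nonneg LDη.2 hMDGnn
  have hf_bd : ∀ α, ∀ V ∈ D, ∀ W ∈ D,
      |q α V - q α W - fderiv ℝ η W (G α V - G α W)| ≤ Cf * ‖V - W‖ ^ 2 :=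
    fun α V hV W hW => fluxDefect_le hO hη1 (hG1 α) (hq1 α) (fun V _ => hcompat V α) hD hDconv
      hLDη (hMDG α) hV hW
  have hZ_bd : ∀ α, ∀ V ∈ D, ∀ W ∈ D,
      ‖G α V - G α W - fderiv ℝ (G α) W (V - W)‖ ≤ LDG * ‖V - W‖ ^ 2 :=
    fun α V hV W hW => taylorDefect_le hO (hG1 α) hD hDconv (hLDG α) hV hW
  set S : Set (ℝ × EuclideanSpace ℝ (Fin m)) := Ioo 0 T ×ˢ univ with hSdef
  have hSD_Ū : ∀ p ∈ S, U p.1 p.2 ∈ D := fun p hp => hŪD p.1 (Ioo_subset_Ico_self hp.1) p.2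
  -- `h`, `Y_α`, `Z_α` as `ν_{t,x}`-averages of the pointwise Taylor remainders
  set hrel : ℝ × EuclideanSpace ℝ (Fin m) → ℝ := fun p =>
    ην p - η (U p.1 p.2) - fderiv ℝ η (U p.1 p.2) (uν p - U p.1 p.2) with hhrel
  have hrel_eq : ∀ p : ℝ × EuclideanSpace ℝ (Fin m), hrel p
      = ∫ ξ, (η ξ - η (U p.1 p.2) - fderiv ℝ η (U p.1 p.2) (ξ - U p.1 p.2)) ∂ν p.1 p.2 := fun p =>
    integral_taylorRemainder_eq (hi_η p.1 p.2) (hi_id p.1 p.2) (fderiv ℝ η (U p.1 p.2)) _ _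
  have hY_eq : ∀ α (p : ℝ × EuclideanSpace ℝ (Fin m)),
      qν α p - q α (U p.1 p.2) - fderiv ℝ η (U p.1 p.2) (gν α p - G α (U p.1 p.2))
        = ∫ ξ, (q α ξ - q α (U p.1 p.2) - fderiv ℝ η (U p.1 p.2) (G α ξ - G α (U p.1 p.2)))
            ∂ν p.1 p.2 := fun α p =>
    integral_taylorRemainder_eq (hi_q α p.1 p.2) (hi_G α p.1 p.2) (fderiv ℝ η (U p.1 p.2)) _ _
  have hZ_eq : ∀ α (p : ℝ × EuclideanSpace ℝ (Fin m)),
      gν α p - G α (U p.1 p.2) - fderiv ℝ (G α) (U p.1 p.2) (uν p - U p.1 p.2)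
        = ∫ ξ, (G α ξ - G α (U p.1 p.2) - fderiv ℝ (G α) (U p.1 p.2) (ξ - U p.1 p.2))
            ∂ν p.1 p.2 := fun α p =>
    integral_taylorRemainder_eq (hi_G α p.1 p.2) (hi_id p.1 p.2) (fderiv ℝ (G α) (U p.1 p.2)) _ _
  have hrem_int : ∀ p : ℝ × EuclideanSpace ℝ (Fin m), Integrable
      (fun ξ => η ξ - η (U p.1 p.2) - fderiv ℝ η (U p.1 p.2) (ξ - U p.1 p.2)) (ν p.1 p.2) :=
    fun p => ((hi_η p.1 p.2).sub (integrable_const _)).sub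
      ((fderiv ℝ η (U p.1 p.2)).integrable_comp ((hi_id p.1 p.2).sub (integrable_const _)))
  have hrel_ge : ∀ p ∈ S, c / 2 * ∫ ξ, ‖ξ - U p.1 p.2‖ ^ 2 ∂ν p.1 p.2 ≤ hrel p := by
    intro p hp
    rw [hrel_eq p, ← integral_const_mul]
    refine integral_mono_ae ((hi_sq p).const_mul _) (hrem_int p) ?_
    filter_upwards [hνD p.1 p.2] with ξ hξ
    exact hlow ξ hξ _ (hSD_Ū p hp)
  have hY_le : ∀ p ∈ S, ∀ α,
      |qν α p - q α (U p.1 p.2) - fderiv ℝ η (U p.1 p.2) (gν α p - G α (U p.1 p.2))|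
        ≤ Cf * ∫ ξ, ‖ξ - U p.1 p.2‖ ^ 2 ∂ν p.1 p.2 := by
    intro p hp α
    rw [hY_eq α p, ← Real.norm_eq_abs, ← integral_const_mul]
    refine norm_integral_le_of_norm_le ((hi_sq p).const_mul _) ?_
    filter_upwards [hνD p.1 p.2] with ξ hξ
    rw [Real.norm_eq_abs]
    exact hf_bd α ξ hξ _ (hSD_Ū p hp)
  have hZ_le : ∀ p ∈ S, ∀ α,
      ‖gν α p - G α (U p.1 p.2) - fderiv ℝ (G α) (U p.1 p.2) (uν p - U p.1 p.2)‖
        ≤ LDG * ∫ ξ, ‖ξ - U p.1 p.2‖ ^ 2 ∂ν p.1 p.2 := by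
    intro p hp α
    rw [hZ_eq α p, ← integral_const_mul]
    refine norm_integral_le_of_norm_le ((hi_sq p).const_mul _) ?_
    filter_upwards [hνD p.1 p.2] with ξ hξ
    exact hZ_bd α ξ hξ _ (hSD_Ū p hp)
  have hsq_nn : ∀ p : ℝ × EuclideanSpace ℝ (Fin m), 0 ≤ ∫ ξ, ‖ξ - U p.1 p.2‖ ^ 2 ∂ν p.1 p.2 :=
    fun p => integral_nonneg fun ξ => sq_nonneg _
  have hh_nn : ∀ p ∈ S, 0 ≤ hrel p :=
    fun p hp => le_trans (mul_nonneg (by positivity) (hsq_nn p)) (hrel_ge p hp)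
  have hsq_le : ∀ p ∈ S, ∫ ξ, ‖ξ - U p.1 p.2‖ ^ 2 ∂ν p.1 p.2 ≤ 2 / c * hrel p := by
    intro p hp
    have := hrel_ge p hp
    rw [← div_le_iff₀' (by positivity)]
    calc (∫ ξ, ‖ξ - U p.1 p.2‖ ^ 2 ∂ν p.1 p.2) / (2 / c)
        = c / 2 * ∫ ξ, ‖ξ - U p.1 p.2‖ ^ 2 ∂ν p.1 p.2 := by field_simp
      _ ≤ _ := this
  set s : ℝ := (m : ℝ) * (2 * Cf / c) + 1 with hsdef
  have hspos : 0 < s := by positivity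
  have hf_sum : ∀ p ∈ S,
      ∑ α : Fin m, |qν α p - q α (U p.1 p.2) - fderiv ℝ η (U p.1 p.2) (gν α p - G α (U p.1 p.2))|
        ≤ s * hrel p := by
    intro p hp
    have hh := hh_nn p hp
    have h1 : ∀ α, |qν α p - q α (U p.1 p.2) - fderiv ℝ η (U p.1 p.2) (gν α p - G α (U p.1 p.2))|
        ≤ 2 * Cf / c * hrel p := by
      intro α
      refine (hY_le p hp α).trans ?_
      rw [show 2 * Cf / c * hrel p = Cf * (2 / c * hrel p) by ring]
      exact mul_le_mul_of_nonneg_left (hsq_le p hp) hCfnn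
    calc ∑ α : Fin m, |qν α p - q α (U p.1 p.2)
            - fderiv ℝ η (U p.1 p.2) (gν α p - G α (U p.1 p.2))|
        ≤ ∑ _α : Fin m, 2 * Cf / c * hrel p := Finset.sum_le_sum fun α _ => h1 α
      _ = (m : ℝ) * (2 * Cf / c) * hrel p := by
          rw [Finset.sum_const, Finset.card_univ, Fintype.card_fin, nsmul_eq_mul]; ring
      _ ≤ s * hrel p := mul_le_mul_of_nonneg_right (by linarith) hh
  have hCZnn : 0 ≤ (LDG : ℝ) * (2 / c) := by positivity
  have hZ_bd' : ∀ p ∈ S, ∀ α : Fin m,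
      ‖gν α p - G α (U p.1 p.2) - fderiv ℝ (G α) (U p.1 p.2) (uν p - U p.1 p.2)‖
        ≤ LDG * (2 / c) * hrel p := by
    intro p hp α
    refine (hZ_le p hp α).trans ?_
    rw [mul_assoc]
    exact mul_le_mul_of_nonneg_left (hsq_le p hp) LDG.2
  ----------------------------------------------------------------
  -- `h = 0` a.e. on the slab, hence `ν_{t,x} = δ_{U(t,x)}`
  ----------------------------------------------------------------
  have hvan := relEntropy_vanish_fields hG hη hq hcompat hDc hDconv hUw hŪD hŪlip
    hum.aestronglyMeasurable (fun α => (hgm α).aestronglyMeasurable) hηνm.aestronglyMeasurable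
    (fun α => (hqνm α).aestronglyMeasurable) huM hgM hηνM hqνM hweak hent hspos hh_nn hf_sum
    hCZnn hZ_bd'
  filter_upwards [hvan] with p hp ht
  have hpS : p ∈ S := ⟨ht, mem_univ _⟩
  have h0 : hrel p = 0 := hp ht
  have h1 := hrel_ge p hpS
  rw [h0] at h1
  have h2 : ∫ ξ, ‖ξ - U p.1 p.2‖ ^ 2 ∂ν p.1 p.2 = 0 := by
    refine le_antisymm ?_ (hsq_nn p)
    by_contra h3
    push Not at h3
    have : 0 < c / 2 * ∫ ξ, ‖ξ - U p.1 p.2‖ ^ 2 ∂ν p.1 p.2 := mul_pos (by positivity) h3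
    linarith
  have h3 : ∀ᵐ ξ ∂ν p.1 p.2, ξ = U p.1 p.2 := by
    have hnn : 0 ≤ᵐ[ν p.1 p.2] fun ξ => ‖ξ - U p.1 p.2‖ ^ 2 := by
      filter_upwards with ξ using sq_nonneg _
    have h4 := (integral_eq_zero_iff_of_nonneg_ae hnn (hi_sq p)).1 h2
    filter_upwards [h4] with ξ hξ
    have hξ' : ‖ξ - U p.1 p.2‖ ^ 2 = 0 := hξ
    rwa [sq_eq_zero_iff, norm_eq_zero, sub_eq_zero] at hξ'
  exact eq_dirac_of_ae_eq h3

end Literature.Analysis.PDE.ConservationLaw
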